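import Summits.CriticalPhenomena.SAWScalingLimit.Theses.SAWDevelopingMap
import Summits.CriticalPhenomena.SAWScalingLimit.Theses.SAWBetheAnsatz
import Summits.CriticalPhenomena.SAWScalingLimit.Theses.SAWAsymptoticMorera
import Summits.CriticalPhenomena.SAWScalingLimit.Theses.SAWEdgeOfPositiveType
import Summits.CriticalPhenomena.SAWScalingLimit.Theses.SAWChargeContinuation
import Literature.Probability.LatticeModels.TriangularLatticeProofs
import Literature.Probability.Percolation.LoopRebasing
import Literature.Probability.RandomPlanarGeometry.CurveTortuosity
import Literature.Probability.RandomPlanarGeometry.CurveTightness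
import Literature.Probability.Percolation.InterfaceScalingLimitProofs

/-!
# Disproof work file — crux `HexTight` (stmt-CriticalPhenomena-5423), cdisprove generations 2–3

The crux (shared verbatim by the routes SAWResidueField / SAWWindingAlias / SAWDevelopingMap /
SAWPhaseRetrieval / SAWDefectDecoherence):

  `HexTight : ∀ (D : DobrushinDomain) (a b : ℝ → HexVertex),
      IsEmbEndpointApprox hexGraph hexCenter D a b →
      IsTightAlongMesh (fun δ (γ : HexDomainSAW D.carrier δ (a δ) (b δ)) ↦ γ.curve)
                       (fun δ ↦ hexSAWLaw D.carrier δ (a δ) (b δ))`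

i.e. EVENTUAL (along `𝓝[>] 0`) Billingsley tightness on `CurveClass ℂ` of the critical
hexagonal-lattice SAW laws of Duminil-Copin–Smirnov.

## Findings (index; every claim below is a checked theorem unless marked NEAR-MISS)

* §1 `junk regimes` — every junk value of the formalisation HELPS the statement:
  no SAW from `a δ` to `b δ` (in particular `¬ Reachable`) ⇒ `hexSAWLaw = 0` and the tightness
  inequality is `0 ≤ ε` (`hexSAWLaw_eq_zero_of_not_reachable`,
  `isTightAlongMesh_of_eventually_not_reachable`): the field `IsEmbEndpointApprox.reachable` is
  NOT load-bearing (it only guarantees honesty of the laws).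
* §2 `load-bearing` — the two endpoint-limit fields `tendsto_fst`/`tendsto_snd` ARE load-bearing,
  but only through the loophole that `Reachable (a δ) (a δ)` holds by reflexivity for vertices
  OUTSIDE the domain: `hexTight_false_without_endpointLimits` (unit disc, coincident endpoints
  `far δ = ((⌈δ⁻²⌉₊, 0), up)` of norm `≥ δ⁻¹`: the law is the Dirac mass at a constant curve
  escaping every compact set, `CurveClass.source` being continuous).
* §2b `confinement` — as soon as the first endpoint is a vertex of `Ω_δ` (e.g. `a δ ≠ b δ` and
  reachable), every SAW curve has trace in `closure Ω` (`curve_range_subset_closure_of_ne`):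
  positions cannot escape, so an honest counterexample to `HexTight` must be an OSCILLATION
  (equicontinuity-modulo-reparametrisation) failure of the critical SAW — i.e. a disproof of the
  regularity half of the SLE(8/3) conjecture. No such mechanism is known; the crux RESISTS.
* §3 `coordinates` — `hexCenter v = (A/2, √3 B/6)` with integers `A = 2x₀+x₁+k+1`,
  `B = 3x₁+k+1`, and the potential `N = 3A²+B² = 12‖hexCenter v‖²` (`normSq_hexCenter`); DESCENT:
  every face off the central hexagon `{U0,U1,U2,D0,D1,D2}` (`N = 4`) has a neighbour of smaller
  `N` (`exists_adj_cN_lt`).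
* §3b `disc connectivity` — hence the honeycomb discretisation of the unit disc is connected
  THROUGH the disc at every mesh (`preconnected_disc`), `Ω_δ(𝔻) = δℍ ∩ 𝔻`
  (`embMeshDomain_disc_eq`), and any two faces of the rescaled disc are joined in `Ω_δ(𝔻)`
  (`reachable_disc`).
* §3c `first inhabitant` — `isEmbEndpointApprox_unitDisc`: the up faces of the cells
  `(⌈δ⁻¹⌉-2, 0)` and `(1-⌈δ⁻¹⌉, 0)` form an honest hexagonal endpoint approximation of
  `(𝔻; 1, -1)` (in the disc and joined for `δ ≤ 1/2`, at distance `< 2δ` from `±1`); so the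
  hypothesis of the crux is NOT vacuous (`crux_hypothesis_inhabited`).
* §3d `honesty` — bounded `Ω`, `δ > 0`: finitely many faces (`finite_embMeshVertices`, box bound
  `|xᵢ| ≤ 2(M/δ+2)`), finitely many SAWs (`finite_hexDomainSAW`, injection into
  `hexGraph.finsetWalkLengthLT`, with the instance `hexLocallyFinite`), and joined endpoints give
  PROBABILITY laws (`isProbabilityMeasure_hexSAWLaw_of_reachable`, `…_disc`).
* §3e `strengthenings` — three natural strengthenings, each PROVED to imply the crux and each
  REFUTED: S1 `HexTightAllMeshes` (the all-`δ ∈ (0,1]` `IsTightLaws` form, hexagonal twin of the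
  refuted stmt-0772) — `not_hexTightAllMeshes`; S2 `HexTightUniformThreshold` (a threshold `δ₀`
  uniform over the endpoint approximations of a domain; quantifier swap of stmt-4997) —
  `not_hexTightUniformThreshold` (both by SPLICING the honest disc approximation below `δ₁` with far
  coincident endpoints above it: `not_isTightMeasureSet_splice`); S3 `HexTightFiniteNet` (finite
  net instead of compact set) — `not_hexTightFiniteNet` (honest disc laws are probability measures
  whose curves start at height `δ√3/6`, injective in `δ`). MORAL for provers: the compact set must
  be a genuine continuum of curves and the threshold must depend on the approximation; only the
  EVENTUAL, per-approximation, compact form — the crux as filed — survives.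

* §4 `window + dedup` — `window_compact`: for bounded `Ω` and meshes `δ ∈ [δ₁, δ₀]`, `δ₁ > 0`,
  ONE compact subset of `CurveClass ℂ` contains every honest SAW curve (uniform polylines,
  `tortuosity_le_of_lipschitz` + Aizenman–Burchard's `isCompact_closure_image_mk_of_tortuosity_le`):
  there is NO obstruction at positive mesh, the content is `δ → 0` only. Consequently
  `hexEventualTight_iff_crux`: **`HexTight` (stmt-5423) ↔ `SAWBetheAnsatz.HexEventualTight`
  (stmt-4997)** — ONE crux filed twice (planners: dedup; provers: either form will do, the `∃ δ₀`
  set-level form is the output shape of the tree's AB criterion `isTightMeasureSet_of_traversalBounds`).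

* §5 `δℤ² twins` (appendix) — the same equivalence for the square lattice:
  `z2_setForm_iff_alongMesh`: `SAWEdgeOfPositiveType.EventualTight` (stmt-1372, `∃ δ₀` form)
  ↔ `SAWAsymptoticMorera.EventualTight` (stmt-1881, along the mesh), and
  `z2_chargeContinuation_iff_setForm`: stmt-4922 ↔ stmt-1372 (`Iff.rfl`) — one `δℤ²` tightness
  crux filed three times across ~12 routes (`z2_window_compact` is the `δℤ²` window lemma).

* §6 `AB rung` — what EXACTLY is left: `crux_of_traversalBound : (∀ D a b, IsEmbEndpointApprox … →
  HexTraversalBound D a b) → Crux`, where `HexTraversalBound` is Aizenman–Burchard's hypothesis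
  (H1) for the hexagonal SAW law (power bound `K (ρ/R)^λ`, `λ > 2`, on `k(x,ρ,R)` separate shell
  traversals, `δ ≤ ρ < R ≤ 1`, small `δ`, SHELL-DEPENDENT threshold — a constant threshold is false
  near rough marked points). The criterion's other hypothesis, the short-distance cutoff (H0), is
  PROVED for every SAW polyline (`not_hasTraversals_sawCurve`, threshold `hexCutoff = 2(338²+1)+1`:
  `≤ 338` faces within `2δ` of any point, each visited once), via the tree's
  `hasOrdConnectedCover_preimage_polylineFrom` / `segMeetCount_map_le_card` /
  `le_of_hasTraversals_of_hasOrdConnectedCover` and `isTightMeasureSet_of_traversalBounds`.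

* §7 `ring barrier` (generation 3, LANDED SEPARATELY as the proposal chain
  `Theorems/HexTight/Negative/LatticeG2{Defs,Ring,Routes,False}.lean`, theorem
  `Negative.not_latticeG2AsTyped`, rc0 / 0 sorry / std axioms): Kemppainen–Smirnov's Condition G2 in
  CONSTANT form for the pinned critical SAW, quantified over ALL finite hexagonal domains (the typed
  `TipRenewalComplementarity.LatticeG2` of the line `tip-renewal-complementarity` = conclusion of its
  `stub_floatingPast`, hypothesis of its `stub_traversalBound_of`) is FALSE for a purely topological
  reason: in a RING of cells (a hole) every arc from the centre cell `v₀` to a far cell `v₁` crosses the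
  annulus `A(c(v₀); r, R)` inside one of the two arms, each arm is a separate annulus component and each
  is UNFORCED (the route through the other arm avoids it), so the unforced-crossing mass equals the total
  mass `> 0` and no `q < 1` exists (for every `C > 1`, `n₁`). The same disease (quantification over all
  bounded `Ω : Set ℂ` and all pasts, holes allowed) affects `DifferentiatedSumRule.OutwardDiveBound` /
  `PinnedReturnBound` (line `differentiated-sum-rule`, stubs 4–5): with an ASYMMETRIC ring the `x_c^ℓ`
  weights put mass fraction `→ 1` on the short arm although it is "Unforced" — PROVED for
  `OutwardDiveBound` (the statement of the REGISTERED unconditional stub `stub_outwardDive`):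
  `Negative.not_outwardDiveBoundAsTyped : ¬ DSR.OutwardDiveBound` (verbatim copy), proposal chain
  (rc0 / 0 sorry / std axioms, checked monolithically as `Dev8.lean` in the disprover's folder): `Ω = ⋃_{v ∈ ring K} B(c v, 3/10)` realises
  the ring as `Ω_1` (distinct centres `≥ 1/√3` apart, edges `< 3/5`, connectivity ⇒ largest component =
  ring); forced progression (no ring cell has three ring neighbours ⇒ a nodup chain is determined by its
  first two cells and its last cell) shows EVERY SAW `v₀ → v₁` is the right one (`ℓ ≤ 8K+1`, crosses the
  Unforced component outward) or leftward (`ℓ ≥ 14K-1`, at most one), so `2·W{cross} ≤ W{all}` reads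
  `2x^{ℓ_R} ≤ x^{ℓ_R} + x^{14K-1}` — false; and `Negative.not_pinnedReturnBoundAsTyped :
  ¬ DSR.PinnedReturnBound` (conclusion of `stub_pinnedReturn_of`) — the same ring read backwards
  (`a = v₁`, past `[v₁]`, `b = v₀`; reversal is a weight-preserving bijection). Files:
  `Theorems/HexTight/Negative/{RingDegree, RingDomain, OutwardDiveDefs, RingTwoSAW, OutwardDiveFalse}.lean`.
  NOT affected: `LatticeG2SC` (simply connected: a cross-cut separates, an unforced crossing is a U-turn),
  the double-crossing statements `TipNoReturn` / `CoherentDecay` / `PinnedDecoupling`, the annealed AB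
  rung `HexTraversalBound` (§6) and every statement of the line `reversal-virgin-disc` (virgin disc with
  both doors on the rim: the non-diving / non-traversing alternative INSIDE the disc is always available at
  polynomial cost, so neither holes nor corridors in the exterior can force dives). VACUITY TRAP for
  leads: with `¬LatticeG2`, `TipRenewalComplementarity.stub_traversalBound_of : LatticeG2 → …` is provable
  ex falso and `stub_floatingPast : LatticeG2SC → LatticeG2` is equivalent to `¬LatticeG2SC` — closing
  either is NOT progress; S6/S7 must be re-typed (feed S7 from `LatticeG2SC` plus an honest treatment of
  the walk's own floating past, or restrict `LatticeG2` to slit domains `Ω_δ-vertices ∖ η`).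
* §7c `the barrier is NOT an artefact of the over-general Ω` (generation 3, on paper — provers of EVERY
  Kemppainen–Smirnov-type line read this): the confining ring arises in HONEST configurations too. Take any
  Dobrushin domain `(D; a, b)` whose two boundary arcs between `a` and `b` have different lengths
  `ℓ₁ < ℓ₂`, mesh `δ`, `a δ` an interior cell next to the boundary layer (allowed: `IsEmbEndpointApprox` only
  asks `δ c(a δ) → a`), and the PAST `π` = the SAW from `a δ` running once around the domain along the
  SECOND layer of cells and stopping at the tip `t` next to `a δ` (positive probability). Then
  `Ω_δ ∖ π.dropLast` = (outer boundary layer: a ring corridor of width one — exactly so for lattice-aligned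
  polygonal `D`, up to pockets for curved `∂D`) ∪ {t} ∪ (interior, SEALED by `π ∪ {t}`): the futures from `t`
  that reach `b δ` are the two ways round the corridor, of lattice lengths `≈ ℓ₁/δ` and `ℓ₂/δ`, each
  crossing an "unforced" annulus component about `t`, with weight ratio `x_c^{-(ℓ₂-ℓ₁)/δ} → ∞`: the
  conditional probability of crossing the short-side component tends to `1` as `δ → 0`. (With `a δ` ON the
  boundary layer the past can still hug layer 3 leaving a width-2 corridor with passable pinches; the strip
  growth rate `λ₂ < 1/x_c` keeps the long way exponentially negligible.) HENCE: constant-form G2 conditioned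
  on arbitrary pasts/stopping times is FALSE for the critical lattice SAW in every such domain along
  `δ → 0` — the failure of `LatticeG2` / `OutwardDiveBound` / `PinnedReturnBound` is not repaired by
  restricting `Ω` to Dobrushin carriers and `π` to honest prefixes. ROBUST REPAIRS: (i) count only U-TURNS
  (double crossings of one component: `TipNoReturn`, `CoherentDecay`, `PinnedDecoupling` of
  `tip-renewal-complementarity`), (ii) condition only on pasts that are hitting times of the annulus being
  crossed with the KS topology re-done for doubly connected slit domains, or (iii) go annealed
  (Aizenman–Burchard (H1), §6) / virgin-disc (`reversal-virgin-disc`). This is a genuine difference between a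
  WEIGHTED polymer and the configuration models of KS17 §4 (FK, percolation, harmonic explorer), where an
  exponentially long forced detour costs nothing.
* §7b `reversal-virgin-disc audit` (generation 3, no kill): `DiveRecursion` checked by hand against the
  `HexMidEdgeSAW` fields (cut at first entrance / last exit; `Straddles` doors `m ≠ m'` because the two
  outside vertices differ unless `w = w'`, where only the trivial arc exists and `diveMass = 0`; gluing back
  respects `edges_nodup` since `u ∉ Λ`) — exact and provable as typed. TYPING REMARK on
  `RootedShellBound`: `IsVirgin.adj` only LOWER-bounds `H` by `hexGraph` inside the `(N+1)`-disc, so the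
  hypothesis `H.Adj q p` allows a NON-lattice pair `{q, p}` with `q` ANY vertex of `Λ ∖ {p}` (the arc then
  ends at `q`; `HexMidEdgeSAW` does not require the final mid-edge to be a lattice edge): as typed the stub
  is the stronger "door-to-arbitrary-endpoint" shell bound — still plausible, but the intended statement has
  `hexGraph.Adj q p` (or `H ≤ hexGraph`).

WHY IT RESISTS (summary for the provers). Every junk regime favours the statement (§1); mass cannot
escape (§2b); positive meshes are free (§4); the hypothesis is inhabited (§3c) and honest laws are
probability measures (§3d). What is left is exactly Billingsley/Aizenman–Burchard regularity of the
critical hexagonal SAW as `δ → 0`: uniform control of multiple annulus crossings (AB99 hypothesis H1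
/ Kemppainen–Smirnov Condition G2). No sub/super-multiplicativity, RSW or FKG tool delivers it at
`n = 0` (KS17 §4 treats FK-Ising, percolation, harmonic explorer, LERW/UST only; DCS12 pose
Conjecture 1 with no tightness claim; Krachun–Panagiotis 2023 still call the planar SAW limit
conjectural); conversely a counterexample would be a quantitative NON-regularity theorem for
critical SAW contradicting the SLE(8/3) prediction — no such mechanism is known. CAVEAT for the
glue item `ObservableToSLE`: the Loewner/KS17 route to SLE needs the CONDITIONAL (domain-Markov,
slit-domain-uniform) form of Condition G2, strictly more than the unconditional `HexTight` filed.

(Generation 1 of this seat — evidence files 20260815T22{1709,2919,4132}Z-Disproof.lean on the item,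
not readable from this hub — recorded the same content; this file is its checked reconstruction.)
-/

noncomputable section

open MeasureTheory Filter Topology Set Metric
open Literature.Probability.RandomPlanarGeometry Literature.Probability.RandomPlanarGeometry.SAW
  Literature.Probability.LatticeModels
open scoped ENNReal NNReal

namespace Summit.CriticalPhenomena.SAWScalingLimit.Cruxes.HexTight.Disproof

/-- The crux under attack, by name (all route copies are syntactically equal). -/
abbrev Crux : Prop := Summit.CriticalPhenomena.SAWScalingLimit.Theses.SAWDevelopingMap.HexTight

/-! ## §1 Junk regimes favour the statement -/

section JunkRegimes

variable {V : Type*} {G : SimpleGraph V} {emb : V → ℂ} {Ω : Set ℂ} {δ x : ℝ} {a b : V}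

/-- No walk, no SAW: if `a` and `b` are not joined in `Ω_δ` the type of SAWs is empty. -/
theorem isEmpty_embDomainSAW_of_not_reachable
    (h : ¬ (embDomainGraph G emb Ω δ).Reachable a b) : IsEmpty (EmbDomainSAW G emb Ω δ a b) :=
  ⟨fun γ => h ⟨γ.walk⟩⟩

/-- On an empty SAW type the weight is the zero measure. -/
theorem embWeight_eq_zero_of_isEmpty [IsEmpty (EmbDomainSAW G emb Ω δ a b)] :
    embWeight G emb Ω δ x a b = 0 :=
  Measure.eq_zero_of_isEmpty _

/-- On an empty SAW type the law is the zero measure (Mathlib junk `0⁻¹ • 0 = 0`). -/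
theorem embLaw_eq_zero_of_isEmpty [IsEmpty (EmbDomainSAW G emb Ω δ a b)] :
    embLaw G emb Ω δ x a b = 0 :=
  Measure.eq_zero_of_isEmpty _

/-- `hexSAWLaw Ω δ a b = 0` when `a`, `b` are not joined in `Ω_δ`. -/
theorem hexSAWLaw_eq_zero_of_not_reachable {a b : HexVertex}
    (h : ¬ (hexDomainGraph Ω δ).Reachable a b) : hexSAWLaw Ω δ a b = 0 := by
  haveI := isEmpty_embDomainSAW_of_not_reachable h
  exact embLaw_eq_zero_of_isEmpty

/-- The tightness inequality is trivially true at every mesh where the endpoints are not joined. -/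
theorem law_compl_le_of_not_reachable {a b : HexVertex}
    (h : ¬ (hexDomainGraph Ω δ).Reachable a b) (K : Set (CurveClass ℂ)) (ε : ℝ≥0∞) :
    hexSAWLaw Ω δ a b ((fun γ : HexDomainSAW Ω δ a b => γ.curve) ⁻¹' Kᶜ) ≤ ε := by
  rw [hexSAWLaw_eq_zero_of_not_reachable h]
  simp

/-- `reachable` is NOT load-bearing: a family that is eventually NOT reachable is (vacuously)
tight along the mesh, with the empty compact set. -/
theorem isTightAlongMesh_of_eventually_not_reachable {a b : ℝ → HexVertex}
    (h : ∀ᶠ δ in 𝓝[>] (0 : ℝ), ¬ (hexDomainGraph Ω δ).Reachable (a δ) (b δ)) :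
    IsTightAlongMesh (fun δ (γ : HexDomainSAW Ω δ (a δ) (b δ)) => γ.curve)
      (fun δ => hexSAWLaw Ω δ (a δ) (b δ)) := by
  intro ε _
  exact ⟨∅, isCompact_empty, h.mono fun δ hδ => law_compl_le_of_not_reachable hδ _ _⟩

end JunkRegimes

/-! ## §2 Load-bearing hypotheses: the endpoint limits -/

section Coincident

variable {Ω : Set ℂ} {δ : ℝ} {v : HexVertex}

/-- With coincident endpoints the only SAW is the trivial one. -/
instance uniqueSelf : Unique (HexDomainSAW Ω δ v v) where
  default := EmbDomainSAW.nil v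
  uniq γ := by
    obtain ⟨w, hw⟩ := γ
    obtain rfl : w = SimpleGraph.Walk.nil :=
      SimpleGraph.Walk.eq_nil_iff_nil.2 (SimpleGraph.Walk.isPath_iff_nil.1 hw)
    rfl

theorem default_eq_nil : (default : HexDomainSAW Ω δ v v) = EmbDomainSAW.nil v := rfl

/-- Total weight at coincident endpoints: `x_c ^ 1`. -/
theorem hexSAWWeight_self_univ :
    hexSAWWeight Ω δ v v univ = ENNReal.ofReal hexCriticalFugacity := by
  rw [univ_unique, default_eq_nil, hexSAWWeight_singleton, EmbDomainSAW.vertexCount_nil, pow_one]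

/-- At coincident endpoints the law gives mass `1` to every event containing the trivial SAW. -/
theorem hexSAWLaw_self_apply_of_mem {s : Set (HexDomainSAW Ω δ v v)}
    (hs : EmbDomainSAW.nil v ∈ s) : hexSAWLaw Ω δ v v s = 1 := by
  have hsu : s = univ := eq_univ_of_forall fun γ => by
    rw [Unique.eq_default γ, default_eq_nil]; exact hs
  subst hsu
  have h0 : hexSAWWeight Ω δ v v univ ≠ 0 := by
    rw [hexSAWWeight_self_univ]
    exact (ENNReal.ofReal_pos.2 hexCriticalFugacity_pos_lt_one.1).ne'
  have htop : hexSAWWeight Ω δ v v univ ≠ ∞ := by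
    rw [hexSAWWeight_self_univ]; exact ENNReal.ofReal_ne_top
  show ((hexSAWWeight Ω δ v v univ)⁻¹ • hexSAWWeight Ω δ v v) univ = 1
  rw [Measure.smul_apply, smul_eq_mul, ENNReal.inv_mul_cancel h0 htop]

/-- The source of the trivial SAW's curve is the rescaled centre. -/
theorem curve_nil_source :
    (EmbDomainSAW.nil v : HexDomainSAW Ω δ v v).curve.source = (δ : ℂ) * hexCenter v := by
  simp only [EmbDomainSAW.curve, EmbDomainSAW.nil, CurveClass.source_mk, Curve.source]
  exact SimpleGraph.Walk.toCurve_apply_zero (fun w => (δ : ℂ) * hexCenter w)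
    (SimpleGraph.Walk.nil : (hexDomainGraph Ω δ).Walk v v)

end Coincident

section FarVertex

/-- A far-away up face on the first lattice row: cell `(⌈δ⁻²⌉₊, 0)`. -/
def far (δ : ℝ) : HexVertex := (![((⌈δ⁻¹ ^ 2⌉₊ : ℕ) : ℤ), 0], 0)

theorem hexCenter_far_re (δ : ℝ) : (hexCenter (far δ)).re = (⌈δ⁻¹ ^ 2⌉₊ : ℝ) + 1 / 2 := by
  simp [hexCenter, far, triEmbed]
  norm_num

/-- `‖δ · hexCenter (far δ)‖ ≥ δ⁻¹` for `δ > 0`. -/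
theorem inv_le_norm_far {δ : ℝ} (hδ : 0 < δ) : δ⁻¹ ≤ ‖(δ : ℂ) * hexCenter (far δ)‖ := by
  have hre : ((δ : ℂ) * hexCenter (far δ)).re = δ * ((⌈δ⁻¹ ^ 2⌉₊ : ℝ) + 1 / 2) := by
    rw [Complex.re_ofReal_mul, hexCenter_far_re]
  have hceil : δ⁻¹ ^ 2 ≤ (⌈δ⁻¹ ^ 2⌉₊ : ℝ) := Nat.le_ceil _
  calc δ⁻¹ = δ * δ⁻¹ ^ 2 := by field_simp
    _ ≤ δ * ((⌈δ⁻¹ ^ 2⌉₊ : ℝ) + 1 / 2) := by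
        apply mul_le_mul_of_nonneg_left _ hδ.le; linarith
    _ = |((δ : ℂ) * hexCenter (far δ)).re| := by
        rw [hre, abs_of_nonneg]; positivity
    _ ≤ ‖(δ : ℂ) * hexCenter (far δ)‖ := Complex.abs_re_le_norm _

end FarVertex

/-- `HexTight` with the endpoint-limit fields `tendsto_fst`, `tendsto_snd` of
`IsEmbEndpointApprox` DROPPED (only eventual reachability kept). -/
def HexTightWithoutEndpointLimits : Prop :=
  ∀ (D : DobrushinDomain) (a b : ℝ → HexVertex),
    (∀ᶠ δ in 𝓝[>] (0 : ℝ), (hexDomainGraph D.carrier δ).Reachable (a δ) (b δ)) →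
    IsTightAlongMesh (fun δ (γ : HexDomainSAW D.carrier δ (a δ) (b δ)) => γ.curve)
      (fun δ => hexSAWLaw D.carrier δ (a δ) (b δ))

/-- **Any proof of `HexTight` must use the endpoint limits.** Witness: the unit disc with the
coincident far endpoints `far δ` (reachable from themselves by reflexivity although outside the
domain): the law is the Dirac mass at the constant curve sitting at `δ · hexCenter (far δ)`, of
norm `≥ δ⁻¹ → ∞`, and `CurveClass.source` is continuous, so mass `1` leaves every compact set. -/
theorem hexTight_false_without_endpointLimits : ¬ HexTightWithoutEndpointLimits := by
  intro h
  have hreach : ∀ᶠ δ in 𝓝[>] (0 : ℝ),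
      (hexDomainGraph DobrushinDomain.unitDisc.carrier δ).Reachable (far δ) (far δ) :=
    Eventually.of_forall fun δ => SimpleGraph.Reachable.refl _
  obtain ⟨K, hK, hev⟩ := h DobrushinDomain.unitDisc far far hreach 2⁻¹ (by simp)
  obtain ⟨R, hR⟩ := (isBounded_iff_subset_closedBall 0).1
    (hK.image CurveClass.continuous_source).isBounded
  have hfar : ∀ᶠ δ : ℝ in 𝓝[>] 0, max R 0 < ‖(δ : ℂ) * hexCenter (far δ)‖ := by
    have hm : ∀ᶠ δ : ℝ in 𝓝[>] 0, δ ∈ Ioo (0 : ℝ) (max R 0 + 1)⁻¹ :=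
      Ioo_mem_nhdsGT (by positivity)
    filter_upwards [hm] with δ hδ
    have h1 : max R 0 + 1 < δ⁻¹ := by
      rw [lt_inv_comm₀ (by positivity) hδ.1]; exact hδ.2
    linarith [inv_le_norm_far hδ.1]
  obtain ⟨δ, hδK, hδfar⟩ := (hev.and hfar).exists
  have hnot : (EmbDomainSAW.nil (far δ) :
      HexDomainSAW DobrushinDomain.unitDisc.carrier δ (far δ) (far δ)).curve ∉ K := by
    intro hin
    have := hR (mem_image_of_mem _ hin)
    rw [curve_nil_source, mem_closedBall, dist_zero_right] at this
    linarith [le_max_left R 0]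
  have h1 : hexSAWLaw DobrushinDomain.unitDisc.carrier δ (far δ) (far δ)
      ((fun γ => γ.curve) ⁻¹' Kᶜ) = 1 := hexSAWLaw_self_apply_of_mem hnot
  have hle : hexSAWLaw DobrushinDomain.unitDisc.carrier δ (far δ) (far δ)
      ((fun γ => γ.curve) ⁻¹' Kᶜ) ≤ 2⁻¹ := hδK
  rw [h1] at hle
  exact absurd hle (not_le.2 (ENNReal.inv_lt_one.2 ENNReal.one_lt_two))

/-! ## §2b Confinement: positions cannot escape once the first endpoint is in `Ω_δ` -/

section Confinement

variable {V : Type*} {G : SimpleGraph V} {emb : V → ℂ} {Ω : Set ℂ} {δ : ℝ}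

/-- Trace of the polyline of a walk: base vertex plus the segments of its darts. -/
theorem range_toCurve_subset_of_darts {S : Set ℂ} (f : V → ℂ) {H : SimpleGraph V} :
    ∀ {u v : V} (p : H.Walk u v), f u ∈ S →
      (∀ d ∈ p.darts, segment ℝ (f d.fst) (f d.snd) ⊆ S) → Set.range (p.toCurve f) ⊆ S
  | u, _, SimpleGraph.Walk.nil, hu, _ => by
    have : Set.range ((SimpleGraph.Walk.nil : H.Walk u u).toCurve f) = {f u} := by
      simp [SimpleGraph.Walk.toCurve, polyline]
    rw [this]
    exact singleton_subset_iff.2 hu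
  | u, _, SimpleGraph.Walk.cons (v := w) h p, _, hd => by
    have hc : Set.range ((SimpleGraph.Walk.cons h p).toCurve f) =
        segment ℝ (f u) (f w) ∪ Set.range (p.toCurve f) := by
      cases p <;>
        simp [SimpleGraph.Walk.toCurve, polyline, Path.trans_range, Path.range_segment]
    rw [hc]
    rw [SimpleGraph.Walk.darts_cons] at hd
    have h1 := hd _ List.mem_cons_self
    exact union_subset h1 (range_toCurve_subset_of_darts f p (h1 (right_mem_segment ℝ _ _))
      fun d hd' => hd d (List.mem_cons_of_mem _ hd'))

/-- Every dart of `Ω_δ` has its rescaled segment inside `closure Ω` (definition of the mesh graph). -/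
theorem segment_subset_closure_of_adj {x y : V} (h : (embDomainGraph G emb Ω δ).Adj x y) :
    segment ℝ ((δ : ℂ) * emb x) ((δ : ℂ) * emb y) ⊆ closure Ω :=
  ((embMeshGraph_adj_iff G emb).1 ((embDomainGraph_adj_iff G emb).1 h).1).2

/-- **Confinement.** If the first endpoint's rescaled position lies in `closure Ω` (automatic when
it is a vertex of `Ω_δ`), the trace of every SAW curve lies in `closure Ω`. -/
theorem curve_range_subset_closure {a b : V} (γ : EmbDomainSAW G emb Ω δ a b)
    (ha : (δ : ℂ) * emb a ∈ closure Ω) : γ.curve.range ⊆ closure Ω := by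
  simp only [EmbDomainSAW.curve, CurveClass.range_mk]
  exact range_toCurve_subset_of_darts (fun w => (δ : ℂ) * emb w) γ.walk ha
    fun d _ => segment_subset_closure_of_adj d.adj

/-- A vertex of the discrete domain has its rescaled position in `Ω ⊆ closure Ω`. -/
theorem mem_closure_of_mem_embMeshDomain {a : V} (ha : a ∈ embMeshDomain G emb Ω δ) :
    (δ : ℂ) * emb a ∈ closure Ω :=
  subset_closure (embMeshDomain_subset G emb Ω δ ha)

/-- If `a ≠ b` are joined in `Ω_δ` then `a` is a vertex of the discrete domain. -/
theorem mem_embMeshDomain_of_reachable_of_ne {a b : V} (hab : a ≠ b)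
    (h : (embDomainGraph G emb Ω δ).Reachable a b) : a ∈ embMeshDomain G emb Ω δ := by
  obtain ⟨p⟩ := h
  cases p with
  | nil => exact absurd rfl hab
  | cons hadj _ => exact ((embDomainGraph_adj_iff G emb).1 hadj).2.1

/-- **Confinement for honest endpoint pairs**: with `a ≠ b` joined in `Ω_δ`, every SAW curve from
`a` to `b` has trace in `closure Ω` — so without the endpoint LIMITS but with distinct joined
endpoints, mass can no longer escape to infinity; only oscillation could break tightness. -/
theorem curve_range_subset_closure_of_ne {a b : V} (hab : a ≠ b)
    (h : (embDomainGraph G emb Ω δ).Reachable a b) (γ : EmbDomainSAW G emb Ω δ a b) :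
    γ.curve.range ⊆ closure Ω :=
  curve_range_subset_closure γ
    (mem_closure_of_mem_embMeshDomain (mem_embMeshDomain_of_reachable_of_ne hab h))

end Confinement

/-- `HexTight` without endpoint limits but with DISTINCT eventually-joined endpoints: not
refutable by escape of mass (§2b); an honest counterexample would be a non-tightness theorem for
critical SAW between arbitrary joined vertex families of a Jordan domain. NEAR-MISS / open:
recorded as a `def` only (no claim either way). -/
def HexTightWithoutEndpointLimits' : Prop :=
  ∀ (D : DobrushinDomain) (a b : ℝ → HexVertex),
    (∀ᶠ δ in 𝓝[>] (0 : ℝ), a δ ≠ b δ ∧ (hexDomainGraph D.carrier δ).Reachable (a δ) (b δ)) →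
    IsTightAlongMesh (fun δ (γ : HexDomainSAW D.carrier δ (a δ) (b δ)) => γ.curve)
      (fun δ => hexSAWLaw D.carrier δ (a δ) (b δ))

/-- `HexTight` is the special case of the primed variant in which the endpoints converge to the
two DISTINCT marked points (so they are eventually distinct): the trivial implication. -/
theorem crux_of_withoutEndpointLimits' (h : HexTightWithoutEndpointLimits') : Crux := by
  intro D a b hab
  refine h D a b ?_
  have hd : D.pt 0 ≠ D.pt 1 := fun e => absurd (D.pt_injective e) (by decide)
  obtain ⟨U, W, hU, hW, h0U, h1W, hUW⟩ := t2_separation hd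
  have ha : ∀ᶠ δ : ℝ in 𝓝[>] 0, (δ : ℂ) * hexCenter (a δ) ∈ U :=
    hab.tendsto_fst (hU.mem_nhds h0U)
  have hb : ∀ᶠ δ : ℝ in 𝓝[>] 0, (δ : ℂ) * hexCenter (b δ) ∈ W :=
    hab.tendsto_snd (hW.mem_nhds h1W)
  filter_upwards [ha, hb, hab.reachable] with δ haU hbW hr
  refine ⟨?_, hr⟩
  intro heq
  rw [heq] at haU
  exact Set.disjoint_left.1 hUW haU hbW

/-! ## §3 Honeycomb coordinates and the potential `N = 3A² + B² = 12 ‖hexCenter‖²` -/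

section Coordinates

/-- Twice the real part of `hexCenter v` (an integer). -/
def cA (v : HexVertex) : ℤ := 2 * v.1 0 + v.1 1 + (v.2 : ℕ) + 1

/-- `6/√3` times the imaginary part of `hexCenter v` (an integer, `≡ v.2 + 1 (mod 3)`). -/
def cB (v : HexVertex) : ℤ := 3 * v.1 1 + (v.2 : ℕ) + 1

/-- The potential: `12 ‖hexCenter v‖²`, an integer. -/
def cN (v : HexVertex) : ℤ := 3 * cA v ^ 2 + cB v ^ 2

theorem hexCenter_re (v : HexVertex) : (hexCenter v).re = (cA v : ℝ) / 2 := by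
  rcases v with ⟨x, k⟩
  simp [hexCenter, triEmbed, cA]
  ring

theorem hexCenter_im (v : HexVertex) : (hexCenter v).im = Real.sqrt 3 * (cB v : ℝ) / 6 := by
  rcases v with ⟨x, k⟩
  simp [hexCenter, triEmbed, cB]
  ring

theorem normSq_hexCenter (v : HexVertex) : Complex.normSq (hexCenter v) = (cN v : ℝ) / 12 := by
  have h3 : Real.sqrt 3 ^ 2 = 3 := Real.sq_sqrt (by norm_num)
  rw [Complex.normSq_apply, hexCenter_re, hexCenter_im]
  push_cast [cN]
  linear_combination ((cB v : ℝ) ^ 2 / 36) * h3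

theorem norm_sq_hexCenter (v : HexVertex) : ‖hexCenter v‖ ^ 2 = (cN v : ℝ) / 12 := by
  rw [Complex.sq_norm, normSq_hexCenter]

theorem cN_nonneg (v : HexVertex) : 0 ≤ cN v := by
  unfold cN; positivity

/-- Norm monotonicity: a vertex of no larger potential is no farther from the origin. -/
theorem norm_smul_le_of_cN_le {v w : HexVertex} (h : cN w ≤ cN v) (δ : ℝ) :
    ‖(δ : ℂ) * hexCenter w‖ ≤ ‖(δ : ℂ) * hexCenter v‖ := by
  rw [norm_mul, norm_mul]
  apply mul_le_mul_of_nonneg_left _ (norm_nonneg _)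
  have hw := norm_sq_hexCenter w
  have hv := norm_sq_hexCenter v
  have hle : (cN w : ℝ) ≤ cN v := by exact_mod_cast h
  nlinarith [norm_nonneg (hexCenter w), norm_nonneg (hexCenter v)]

/-! ### The three neighbours and their coordinates -/

/-- up face `(x,0)` ∼ down faces `(x,1)`, `(x-e₀,1)`, `(x-e₁,1)`. -/
theorem adj_up_down (x : Site 2) : hexGraph.Adj (x, 0) (x, 1) :=
  (hexGraph_adj_iff_of_snd_eq_zero_holds x x).2 (Or.inl rfl)

theorem adj_up_down_e0 (x : Site 2) : hexGraph.Adj (x, 0) (x - Pi.single 0 1, 1) :=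
  (hexGraph_adj_iff_of_snd_eq_zero_holds x _).2 (Or.inr (Or.inl rfl))

theorem adj_up_down_e1 (x : Site 2) : hexGraph.Adj (x, 0) (x - Pi.single 1 1, 1) :=
  (hexGraph_adj_iff_of_snd_eq_zero_holds x _).2 (Or.inr (Or.inr rfl))

theorem adj_down_up (x : Site 2) : hexGraph.Adj (x, 1) (x, 0) :=
  (hexGraph_adj_iff_of_snd_eq_one x x).2 (Or.inl rfl)

theorem adj_down_up_e0 (x : Site 2) : hexGraph.Adj (x, 1) (x + Pi.single 0 1, 0) :=
  (hexGraph_adj_iff_of_snd_eq_one x _).2 (Or.inr (Or.inl rfl))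

theorem adj_down_up_e1 (x : Site 2) : hexGraph.Adj (x, 1) (x + Pi.single 1 1, 0) :=
  (hexGraph_adj_iff_of_snd_eq_one x _).2 (Or.inr (Or.inr rfl))

@[simp] theorem cA_up (x : Site 2) : cA (x, 0) = 2 * x 0 + x 1 + 1 := by simp [cA]
@[simp] theorem cB_up (x : Site 2) : cB (x, 0) = 3 * x 1 + 1 := by simp [cB]
@[simp] theorem cA_down (x : Site 2) : cA (x, 1) = 2 * x 0 + x 1 + 2 := by
  simp [cA]; ring
@[simp] theorem cB_down (x : Site 2) : cB (x, 1) = 3 * x 1 + 2 := by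
  simp [cB]; ring

/-- The six faces around the origin (the minima `N = 4` of the potential). -/
def U0 : HexVertex := (![0, 0], 0)
def U1 : HexVertex := (![-1, 0], 0)
def U2 : HexVertex := (![0, -1], 0)
def D0 : HexVertex := (![0, -1], 1)
def D1 : HexVertex := (![-1, -1], 1)
def D2 : HexVertex := (![-1, 0], 1)

/-- **Descent.** Every face other than the six central ones has a neighbour of strictly smaller
potential. -/
theorem exists_adj_cN_lt (v : HexVertex)
    (hv : v ≠ U0 ∧ v ≠ U1 ∧ v ≠ U2 ∧ v ≠ D0 ∧ v ≠ D1 ∧ v ≠ D2) :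
    ∃ w, hexGraph.Adj v w ∧ cN w < cN v := by
  obtain ⟨x, k⟩ := v
  have hx : x = ![x 0, x 1] := by ext i; fin_cases i <;> rfl
  fin_cases k
  · -- up face
    simp only [Fin.zero_eta] at hv ⊢
    by_cases h1 : 1 < 3 * x 1 + 1
    · refine ⟨_, adj_up_down_e1 x, ?_⟩
      simp [cN, Pi.sub_apply]
      nlinarith
    by_cases h2 : 6 * (2 * x 0 + x 1 + 1) + 2 * (3 * x 1 + 1) + 4 < 0
    · refine ⟨_, adj_up_down x, ?_⟩
      simp [cN]
      nlinarith
    by_cases h3 : -6 * (2 * x 0 + x 1 + 1) + 2 * (3 * x 1 + 1) + 4 < 0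
    · refine ⟨_, adj_up_down_e0 x, ?_⟩
      simp [cN, Pi.sub_apply]
      nlinarith
    exfalso
    have hcases : (x 0 = 0 ∧ x 1 = 0) ∨ (x 0 = -1 ∧ x 1 = 0) ∨ (x 0 = 0 ∧ x 1 = -1) := by omega
    rcases hcases with ⟨h0, h1'⟩ | ⟨h0, h1'⟩ | ⟨h0, h1'⟩
    · exact hv.1 (by rw [hx, h0, h1']; rfl)
    · exact hv.2.1 (by rw [hx, h0, h1']; rfl)
    · exact hv.2.2.1 (by rw [hx, h0, h1']; rfl)
  · -- down face
    simp only [Fin.mk_one] at hv ⊢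
    by_cases h1 : 3 * x 1 + 2 < -1
    · refine ⟨_, adj_down_up_e1 x, ?_⟩
      simp [cN, Pi.add_apply]
      nlinarith
    by_cases h2 : -6 * (2 * x 0 + x 1 + 2) - 2 * (3 * x 1 + 2) + 4 < 0
    · refine ⟨_, adj_down_up x, ?_⟩
      simp [cN]
      nlinarith
    by_cases h3 : 6 * (2 * x 0 + x 1 + 2) - 2 * (3 * x 1 + 2) + 4 < 0
    · refine ⟨_, adj_down_up_e0 x, ?_⟩
      simp [cN, Pi.add_apply]
      nlinarith
    exfalso
    have hcases : (x 0 = 0 ∧ x 1 = -1) ∨ (x 0 = -1 ∧ x 1 = -1) ∨ (x 0 = -1 ∧ x 1 = 0) := by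
      omega
    rcases hcases with ⟨h0, h1'⟩ | ⟨h0, h1'⟩ | ⟨h0, h1'⟩
    · exact hv.2.2.2.1 (by rw [hx, h0, h1']; rfl)
    · exact hv.2.2.2.2.1 (by rw [hx, h0, h1']; rfl)
    · exact hv.2.2.2.2.2 (by rw [hx, h0, h1']; rfl)

theorem cN_U0 : cN U0 = 4 := by decide
theorem cN_U1 : cN U1 = 4 := by decide
theorem cN_U2 : cN U2 = 4 := by decide
theorem cN_D0 : cN D0 = 4 := by decide
theorem cN_D1 : cN D1 = 4 := by decide
theorem cN_D2 : cN D2 = 4 := by decide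

/-- the central hexagon `U0 – D0 – U2 – D1 – U1 – D2 – U0` -/
theorem adj_U0_D0 : hexGraph.Adj U0 D0 := by decide
theorem adj_D0_U2 : hexGraph.Adj D0 U2 := by decide
theorem adj_U2_D1 : hexGraph.Adj U2 D1 := by decide
theorem adj_D1_U1 : hexGraph.Adj D1 U1 := by decide
theorem adj_U1_D2 : hexGraph.Adj U1 D2 := by decide
theorem adj_U0_D2 : hexGraph.Adj U0 D2 := by decide

end Coordinates

/-! ## §3b The honeycomb discretisation of the unit disc is connected at every mesh -/

section Disc

/-- the unit disc -/
abbrev 𝔻 : Set ℂ := Metric.ball (0 : ℂ) 1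

theorem unitDisc_carrier : DobrushinDomain.unitDisc.carrier = 𝔻 := rfl

/-- Mesh adjacency in the disc from lattice adjacency (the disc is convex). -/
theorem meshAdj_of_adj {δ : ℝ} {v w : HexVertex} (h : hexGraph.Adj v w)
    (hv : (δ : ℂ) * hexCenter v ∈ 𝔻) (hw : (δ : ℂ) * hexCenter w ∈ 𝔻) :
    (embMeshGraph hexGraph hexCenter 𝔻 δ).Adj v w :=
  (embMeshGraph_adj_iff _ _).2
    ⟨h, ((convex_ball (0 : ℂ) 1).segment_subset hv hw).trans subset_closure⟩

/-- A face of no larger potential than a face of the rescaled disc lies in the rescaled disc. -/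
theorem mem_disc_of_cN_le {δ : ℝ} {v w : HexVertex} (h : cN w ≤ cN v)
    (hv : (δ : ℂ) * hexCenter v ∈ 𝔻) : (δ : ℂ) * hexCenter w ∈ 𝔻 := by
  rw [Metric.mem_ball, dist_zero_right] at hv ⊢
  exact (norm_smul_le_of_cN_le h δ).trans_lt hv

/-- One lattice step inside the disc is a step of the mesh vertex graph. -/
theorem reachable_step {δ : ℝ} {v w : HexVertex} (h : hexGraph.Adj v w)
    (hv : v ∈ embMeshVertices hexCenter 𝔻 δ) (hw : w ∈ embMeshVertices hexCenter 𝔻 δ) :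
    (embMeshVertexGraph hexGraph hexCenter 𝔻 δ).Reachable ⟨v, hv⟩ ⟨w, hw⟩ := by
  refine SimpleGraph.Adj.reachable ?_
  simp only [SimpleGraph.comap_adj, Function.Embedding.subtype_apply]
  exact meshAdj_of_adj h hv hw

/-- **Descent to the central hexagon**: every face of the rescaled disc is joined, inside the
disc, to the face `U0`; by strong induction on the potential. -/
theorem reachable_U0 {δ : ℝ} : ∀ (n : ℕ) (v : HexVertex)
    (hv : v ∈ embMeshVertices hexCenter 𝔻 δ), (cN v).toNat = n →
    ∃ h0 : U0 ∈ embMeshVertices hexCenter 𝔻 δ,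
      (embMeshVertexGraph hexGraph hexCenter 𝔻 δ).Reachable ⟨v, hv⟩ ⟨U0, h0⟩ := by
  intro n
  induction n using Nat.strong_induction_on with
  | _ n ih =>
    intro v hv hn
    by_cases hc : v ≠ U0 ∧ v ≠ U1 ∧ v ≠ U2 ∧ v ≠ D0 ∧ v ≠ D1 ∧ v ≠ D2
    · obtain ⟨w, hadj, hlt⟩ := exists_adj_cN_lt v hc
      have hw : w ∈ embMeshVertices hexCenter 𝔻 δ := mem_disc_of_cN_le hlt.le hv
      have hwn : (cN w).toNat < n := by have := cN_nonneg w; omega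
      obtain ⟨h0, hr⟩ := ih _ hwn w hw rfl
      exact ⟨h0, (reachable_step hadj hv hw).trans hr⟩
    · simp only [not_and_or, ne_eq, not_not] at hc
      have h4 : cN v = 4 := by
        rcases hc with rfl | rfl | rfl | rfl | rfl | rfl <;> decide
      have hmem : ∀ w, cN w = 4 → w ∈ embMeshVertices hexCenter 𝔻 δ := fun w hw =>
        mem_disc_of_cN_le (by rw [hw, h4]) hv
      refine ⟨hmem U0 cN_U0, ?_⟩
      have sU0D0 := reachable_step adj_U0_D0 (hmem U0 cN_U0) (hmem D0 cN_D0)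
      have sU2D1 := reachable_step adj_U2_D1 (hmem U2 cN_U2) (hmem D1 cN_D1)
      have sD0U2 := reachable_step adj_D0_U2 (hmem D0 cN_D0) (hmem U2 cN_U2)
      have sD1U1 := reachable_step adj_D1_U1 (hmem D1 cN_D1) (hmem U1 cN_U1)
      have sU1D2 := reachable_step adj_U1_D2 (hmem U1 cN_U1) (hmem D2 cN_D2)
      have sU0D2 := reachable_step adj_U0_D2 (hmem U0 cN_U0) (hmem D2 cN_D2)
      rcases hc with rfl | rfl | rfl | rfl | rfl | rfl
      · exact SimpleGraph.Reachable.refl _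
      · exact sU1D2.trans sU0D2.symm
      · exact sD0U2.symm.trans sU0D0.symm
      · exact sU0D0.symm
      · exact sD1U1.trans (sU1D2.trans sU0D2.symm)
      · exact sU0D2.symm

/-- **The honeycomb discretisation of the unit disc is connected (through the disc) at every
mesh.** -/
theorem preconnected_disc (δ : ℝ) :
    (embMeshVertexGraph hexGraph hexCenter 𝔻 δ).Preconnected := by
  rintro ⟨v, hv⟩ ⟨w, hw⟩
  obtain ⟨_, hr⟩ := reachable_U0 _ v hv rfl
  obtain ⟨_, hr'⟩ := reachable_U0 _ w hw rfl
  exact hr.trans hr'.symm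

/-- Hence `Ω_δ(𝔻)` is ALL of `δℍ ∩ 𝔻` (one component). -/
theorem mem_embMeshDomain_disc {δ : ℝ} {v : HexVertex}
    (hv : v ∈ embMeshVertices hexCenter 𝔻 δ) : v ∈ embMeshDomain hexGraph hexCenter 𝔻 δ := by
  have hsub := (preconnected_disc δ).subsingleton_connectedComponent
  simp only [embMeshDomain, Set.mem_iUnion, Set.mem_image]
  refine ⟨(embMeshVertexGraph hexGraph hexCenter 𝔻 δ).connectedComponentMk ⟨v, hv⟩,
    fun C' => ?_, ⟨v, hv⟩, ?_, rfl⟩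
  · rw [Subsingleton.elim C'
      ((embMeshVertexGraph hexGraph hexCenter 𝔻 δ).connectedComponentMk ⟨v, hv⟩)]
  · rw [SimpleGraph.ConnectedComponent.mem_supp_iff]

theorem embMeshDomain_disc_eq (δ : ℝ) :
    embMeshDomain hexGraph hexCenter 𝔻 δ = embMeshVertices hexCenter 𝔻 δ :=
  Set.Subset.antisymm (embMeshDomain_subset _ _ _ _) fun _ hv => mem_embMeshDomain_disc hv

/-- Any two faces of the rescaled disc are joined in `Ω_δ(𝔻)`. -/
theorem reachable_disc {δ : ℝ} {v w : HexVertex} (hv : (δ : ℂ) * hexCenter v ∈ 𝔻)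
    (hw : (δ : ℂ) * hexCenter w ∈ 𝔻) : (hexDomainGraph 𝔻 δ).Reachable v w := by
  let hom : embMeshVertexGraph hexGraph hexCenter 𝔻 δ →g hexDomainGraph 𝔻 δ :=
    { toFun := Subtype.val
      map_rel' := fun {p q} h => (embDomainGraph_adj_iff _ _).2
        ⟨h, mem_embMeshDomain_disc p.2, mem_embMeshDomain_disc q.2⟩ }
  exact (preconnected_disc δ ⟨v, hv⟩ ⟨w, hw⟩).map hom

/-- Adjacency of `Ω_δ(𝔻)` is just lattice adjacency of two faces of the rescaled disc. -/
theorem hexDomainGraph_disc_adj_iff {δ : ℝ} {v w : HexVertex} :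
    (hexDomainGraph 𝔻 δ).Adj v w ↔
      hexGraph.Adj v w ∧ (δ : ℂ) * hexCenter v ∈ 𝔻 ∧ (δ : ℂ) * hexCenter w ∈ 𝔻 := by
  rw [hexDomainGraph, embDomainGraph_adj_iff, embMeshDomain_disc_eq]
  constructor
  · rintro ⟨h, hv, hw⟩
    exact ⟨embMeshGraph_le _ _ _ _ h, hv, hw⟩
  · rintro ⟨h, hv, hw⟩
    exact ⟨meshAdj_of_adj h hv hw, hv, hw⟩

end Disc

/-! ## §3c An honest hexagonal endpoint approximation of the unit disc `(𝔻; 1, -1)` -/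

section Endpoints

/-- the cell index of the honest endpoints -/
def mDisc (δ : ℝ) : ℤ := ⌈δ⁻¹⌉ - 2

/-- honest first endpoint: the up face of the cell `(⌈δ⁻¹⌉ - 2, 0)` (centre `→ 1`) -/
def aDisc (δ : ℝ) : HexVertex := (![mDisc δ, 0], 0)

/-- honest second endpoint: the up face of the cell `(1 - ⌈δ⁻¹⌉, 0)` (centre `→ -1`) -/
def bDisc (δ : ℝ) : HexVertex := (![-mDisc δ - 1, 0], 0)

@[simp] theorem vec2_apply_zero (a b : ℤ) : (![a, b] : Site 2) 0 = a := rfl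
@[simp] theorem vec2_apply_one (a b : ℤ) : (![a, b] : Site 2) 1 = b := rfl

@[simp] theorem cA_aDisc (δ : ℝ) : cA (aDisc δ) = 2 * mDisc δ + 1 := by
  simp only [aDisc, cA_up, vec2_apply_zero, vec2_apply_one]; ring

@[simp] theorem cB_aDisc (δ : ℝ) : cB (aDisc δ) = 1 := by
  simp only [aDisc, cB_up, vec2_apply_one]; ring

@[simp] theorem cA_bDisc (δ : ℝ) : cA (bDisc δ) = -(2 * mDisc δ + 1) := by
  simp only [bDisc, cA_up, vec2_apply_zero, vec2_apply_one]; ring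

@[simp] theorem cB_bDisc (δ : ℝ) : cB (bDisc δ) = 1 := by
  simp only [bDisc, cB_up, vec2_apply_one]; ring

theorem re_aDisc (δ : ℝ) :
    ((δ : ℂ) * hexCenter (aDisc δ)).re = δ * ((mDisc δ : ℝ) + 1 / 2) := by
  rw [Complex.re_ofReal_mul, hexCenter_re, cA_aDisc]; push_cast; ring

theorem im_aDisc (δ : ℝ) : ((δ : ℂ) * hexCenter (aDisc δ)).im = δ * (Real.sqrt 3 / 6) := by
  rw [Complex.im_ofReal_mul, hexCenter_im, cB_aDisc]; push_cast; ring

theorem re_bDisc (δ : ℝ) :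
    ((δ : ℂ) * hexCenter (bDisc δ)).re = -(δ * ((mDisc δ : ℝ) + 1 / 2)) := by
  rw [Complex.re_ofReal_mul, hexCenter_re, cA_bDisc]; push_cast; ring

theorem im_bDisc (δ : ℝ) : ((δ : ℂ) * hexCenter (bDisc δ)).im = δ * (Real.sqrt 3 / 6) := by
  rw [Complex.im_ofReal_mul, hexCenter_im, cB_bDisc]; push_cast; ring

theorem sqrt3_sq : Real.sqrt 3 ^ 2 = 3 := Real.sq_sqrt (by norm_num)

theorem normSq_aDisc (δ : ℝ) : Complex.normSq ((δ : ℂ) * hexCenter (aDisc δ)) =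
    (δ * ((mDisc δ : ℝ) + 1 / 2)) ^ 2 + δ ^ 2 / 12 := by
  rw [Complex.normSq_apply, re_aDisc, im_aDisc]
  linear_combination (δ ^ 2 / 36) * sqrt3_sq

theorem normSq_bDisc (δ : ℝ) : Complex.normSq ((δ : ℂ) * hexCenter (bDisc δ)) =
    (δ * ((mDisc δ : ℝ) + 1 / 2)) ^ 2 + δ ^ 2 / 12 := by
  rw [Complex.normSq_apply, re_bDisc, im_bDisc]
  linear_combination (δ ^ 2 / 36) * sqrt3_sq

theorem normSq_aDisc_sub_one (δ : ℝ) : Complex.normSq ((δ : ℂ) * hexCenter (aDisc δ) - 1) =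
    (δ * ((mDisc δ : ℝ) + 1 / 2) - 1) ^ 2 + δ ^ 2 / 12 := by
  rw [Complex.normSq_apply, Complex.sub_re, Complex.sub_im, re_aDisc, im_aDisc, Complex.one_re,
    Complex.one_im]
  linear_combination (δ ^ 2 / 36) * sqrt3_sq

theorem normSq_bDisc_sub_neg_one (δ : ℝ) :
    Complex.normSq ((δ : ℂ) * hexCenter (bDisc δ) - -1) =
    (δ * ((mDisc δ : ℝ) + 1 / 2) - 1) ^ 2 + δ ^ 2 / 12 := by
  rw [Complex.normSq_apply, Complex.sub_re, Complex.sub_im, re_bDisc, im_bDisc, Complex.neg_re,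
    Complex.neg_im, Complex.one_re, Complex.one_im]
  linear_combination (δ ^ 2 / 36) * sqrt3_sq

/-- `δ (m + 1/2) ∈ [1 - 3δ/2, 1 - δ/2)` -/
theorem mDisc_bounds {δ : ℝ} (hδ : 0 < δ) :
    1 - 3 / 2 * δ ≤ δ * ((mDisc δ : ℝ) + 1 / 2) ∧ δ * ((mDisc δ : ℝ) + 1 / 2) < 1 - δ / 2 := by
  have h1 : δ⁻¹ ≤ (⌈δ⁻¹⌉ : ℝ) := Int.le_ceil _
  have h2 : (⌈δ⁻¹⌉ : ℝ) < δ⁻¹ + 1 := Int.ceil_lt_add_one _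
  have hm : (mDisc δ : ℝ) = (⌈δ⁻¹⌉ : ℝ) - 2 := by simp [mDisc]
  have hinv : δ * δ⁻¹ = 1 := mul_inv_cancel₀ hδ.ne'
  rw [hm]
  constructor <;> nlinarith

/-- the honest endpoints lie in the rescaled disc for `0 < δ ≤ 1/2` -/
theorem normSq_aDisc_lt {δ : ℝ} (hδ : 0 < δ) (hδ1 : δ ≤ 1 / 2) :
    Complex.normSq ((δ : ℂ) * hexCenter (aDisc δ)) < 1 := by
  rw [normSq_aDisc]
  obtain ⟨h1, h2⟩ := mDisc_bounds hδ
  set t := δ * ((mDisc δ : ℝ) + 1 / 2)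
  have ht0 : 0 ≤ t := by linarith
  have ht2 : t ^ 2 < (1 - δ / 2) ^ 2 := by nlinarith
  nlinarith

theorem aDisc_mem {δ : ℝ} (hδ : 0 < δ) (hδ1 : δ ≤ 1 / 2) : (δ : ℂ) * hexCenter (aDisc δ) ∈ 𝔻 := by
  rw [Metric.mem_ball, dist_zero_right, ← sq_lt_one_iff₀ (norm_nonneg _), Complex.sq_norm]
  exact normSq_aDisc_lt hδ hδ1

theorem bDisc_mem {δ : ℝ} (hδ : 0 < δ) (hδ1 : δ ≤ 1 / 2) : (δ : ℂ) * hexCenter (bDisc δ) ∈ 𝔻 := by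
  rw [Metric.mem_ball, dist_zero_right, ← sq_lt_one_iff₀ (norm_nonneg _), Complex.sq_norm,
    normSq_bDisc, ← normSq_aDisc]
  exact normSq_aDisc_lt hδ hδ1

/-- distance of the honest endpoints to the marked points: `< 2δ` -/
theorem dist_aDisc_lt {δ : ℝ} (hδ : 0 < δ) : dist ((δ : ℂ) * hexCenter (aDisc δ)) 1 < 2 * δ := by
  rw [Complex.dist_eq, ← sq_lt_sq₀ (norm_nonneg _) (by linarith), Complex.sq_norm,
    normSq_aDisc_sub_one]
  obtain ⟨h1, h2⟩ := mDisc_bounds hδ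
  nlinarith

theorem dist_bDisc_lt {δ : ℝ} (hδ : 0 < δ) :
    dist ((δ : ℂ) * hexCenter (bDisc δ)) (-1) < 2 * δ := by
  rw [Complex.dist_eq, ← sq_lt_sq₀ (norm_nonneg _) (by linarith), Complex.sq_norm,
    normSq_bDisc_sub_neg_one]
  obtain ⟨h1, h2⟩ := mDisc_bounds hδ
  nlinarith

theorem pt_zero_unitDisc : DobrushinDomain.unitDisc.pt 0 = 1 := by
  simp [MarkedDomain.pt, DobrushinDomain.unitDisc, JordanDomain.unitDisc, circleMap]

theorem pt_one_unitDisc : DobrushinDomain.unitDisc.pt 1 = -1 := by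
  simp [MarkedDomain.pt, DobrushinDomain.unitDisc, JordanDomain.unitDisc, circleMap]
  rw [show (2 * (Real.pi : ℂ) * 2⁻¹ * Complex.I) = Real.pi * Complex.I by ring]
  exact Complex.exp_pi_mul_I

theorem tendsto_aDisc :
    Tendsto (fun δ : ℝ => (δ : ℂ) * hexCenter (aDisc δ)) (𝓝[>] 0) (𝓝 1) := by
  rw [Metric.tendsto_nhds]
  intro ε hε
  filter_upwards [Ioo_mem_nhdsGT (show (0 : ℝ) < ε / 2 by positivity)] with δ hδ
  exact (dist_aDisc_lt hδ.1).trans_le (by linarith [hδ.2])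

theorem tendsto_bDisc :
    Tendsto (fun δ : ℝ => (δ : ℂ) * hexCenter (bDisc δ)) (𝓝[>] 0) (𝓝 (-1)) := by
  rw [Metric.tendsto_nhds]
  intro ε hε
  filter_upwards [Ioo_mem_nhdsGT (show (0 : ℝ) < ε / 2 by positivity)] with δ hδ
  exact (dist_bDisc_lt hδ.1).trans_le (by linarith [hδ.2])

/-- **First inhabitant of the hypothesis of `HexTight`**: the honest hexagonal endpoint
approximation of the unit disc `(𝔻; 1, -1)`. -/
theorem isEmbEndpointApprox_unitDisc :
    IsEmbEndpointApprox hexGraph hexCenter DobrushinDomain.unitDisc aDisc bDisc := by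
  refine ⟨?_, ?_, ?_⟩
  · filter_upwards [Ioo_mem_nhdsGT (show (0 : ℝ) < 1 / 2 by norm_num)] with δ hδ
    exact reachable_disc (aDisc_mem hδ.1 hδ.2.le) (bDisc_mem hδ.1 hδ.2.le)
  · rw [pt_zero_unitDisc]; exact tendsto_aDisc
  · rw [pt_one_unitDisc]; exact tendsto_bDisc

/-- Non-vacuity of the crux: its hypothesis is inhabited. -/
theorem crux_hypothesis_inhabited :
    ∃ (D : DobrushinDomain) (a b : ℝ → HexVertex), IsEmbEndpointApprox hexGraph hexCenter D a b :=
  ⟨_, _, _, isEmbEndpointApprox_unitDisc⟩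

end Endpoints

/-! ## §3d Finiteness and honesty of the laws (bounded domain, positive mesh) -/

section Finiteness

/-- every face has finitely many (three) neighbours -/
theorem finite_neighborSet_hexGraph (f : HexVertex) : (hexGraph.neighborSet f).Finite := by
  rcases f with ⟨x, k⟩
  fin_cases k
  · rw [show ((x, ⟨0, by norm_num⟩) : HexVertex) = (x, 0) from rfl, neighborSet_hexGraph_zero]
    exact Finset.finite_toSet _
  · rw [show ((x, ⟨1, by norm_num⟩) : HexVertex) = (x, 1) from rfl, neighborSet_hexGraph_one]
    exact Finset.finite_toSet _

instance hexLocallyFinite : hexGraph.LocallyFinite := fun f =>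
  (finite_neighborSet_hexGraph f).fintype

/-- `‖triEmbed v.1‖ ≤ ‖hexCenter v‖ + 2` -/
theorem norm_triEmbed_le (v : HexVertex) : ‖triEmbed v.1‖ ≤ ‖hexCenter v‖ + 2 := by
  have hζ : ‖triZeta‖ = 1 := by
    rw [← Real.sqrt_sq (norm_nonneg _), Complex.sq_norm, normSq_triZeta, Real.sqrt_one]
  have h1 : ‖(((v.2 : ℕ) : ℂ) + 1) * (1 + triZeta) / 3‖ ≤ 2 := by
    rw [norm_div, norm_mul]
    have hk : ‖((v.2 : ℕ) : ℂ) + 1‖ ≤ 2 := by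
      have h' : ((v.2 : ℕ) : ℝ) + 1 ≤ 2 := by
        have h2 := v.2.isLt
        have h3 : (v.2 : ℕ) + 1 ≤ 2 := by omega
        exact_mod_cast h3
      calc ‖((v.2 : ℕ) : ℂ) + 1‖ ≤ ‖((v.2 : ℕ) : ℂ)‖ + ‖(1 : ℂ)‖ := norm_add_le _ _
        _ = (v.2 : ℕ) + 1 := by rw [Complex.norm_natCast, norm_one]
        _ ≤ 2 := h'
    have h1ζ : ‖1 + triZeta‖ ≤ 2 := (norm_add_le _ _).trans (by rw [hζ]; norm_num)
    have h3 : ‖(3 : ℂ)‖ = 3 := by simp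
    rw [h3, div_le_iff₀ (by norm_num : (0 : ℝ) < 3)]
    nlinarith [norm_nonneg (((v.2 : ℕ) : ℂ) + 1), norm_nonneg (1 + triZeta)]
  have h2 : triEmbed v.1 = hexCenter v - (((v.2 : ℕ) : ℂ) + 1) * (1 + triZeta) / 3 := by
    rw [hexCenter]; ring
  rw [h2]
  exact (norm_sub_le _ _).trans (by linarith)

/-- Faces with centre in a bounded disc are finitely many (box bound `|xᵢ| ≤ 2(M+2)`). -/
theorem finite_norm_hexCenter_le (M : ℝ) : {v : HexVertex | ‖hexCenter v‖ ≤ M}.Finite := by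
  set N : ℕ := ⌈2 * (M + 2)⌉₊ with hN
  refine ((box 2 N ×ˢ (Finset.univ : Finset (Fin 2))).finite_toSet).subset fun v hv => ?_
  have h2 : ‖hexCenter v‖ ≤ M := hv
  have h3 : ∀ i, |(v.1 i : ℝ)| ≤ N := fun i =>
    calc |(v.1 i : ℝ)| ≤ 2 * ‖triEmbed v.1‖ := abs_le_two_mul_norm_triEmbed v.1 i
      _ ≤ 2 * (M + 2) := by linarith [norm_triEmbed_le v]
      _ ≤ N := Nat.le_ceil _
  rw [Finset.mem_coe, Finset.mem_product, mem_box]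
  refine ⟨fun i => ?_, Finset.mem_univ _⟩
  have h4 := h3 i
  rw [abs_le] at h4
  constructor <;> [have := h4.1; have := h4.2] <;> exact_mod_cast this

/-- Faces of the rescaled discretisation of `Ω ⊆ closedBall 0 M` have centres of norm `≤ M/δ`. -/
theorem norm_hexCenter_le_of_mem_embMeshVertices {Ω : Set ℂ} {M : ℝ} (hM : Ω ⊆ closedBall 0 M)
    {δ : ℝ} (hδ : 0 < δ) {v : HexVertex} (hv : v ∈ embMeshVertices hexCenter Ω δ) :
    ‖hexCenter v‖ ≤ M / δ := by
  rw [mem_embMeshVertices_iff] at hv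
  have h1 : ‖(δ : ℂ) * hexCenter v‖ ≤ M := by simpa using hM hv
  rw [norm_mul, Complex.norm_real, Real.norm_eq_abs, abs_of_pos hδ] at h1
  rwa [le_div_iff₀' hδ]

/-- **The honeycomb discretisation of a bounded domain is finite** for `δ > 0`. -/
theorem finite_embMeshVertices {Ω : Set ℂ} (hΩ : Bornology.IsBounded Ω) {δ : ℝ} (hδ : 0 < δ) :
    (embMeshVertices hexCenter Ω δ).Finite := by
  obtain ⟨M, hM⟩ := hΩ.subset_closedBall 0
  exact (finite_norm_hexCenter_le (M / δ)).subset fun v hv =>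
    norm_hexCenter_le_of_mem_embMeshVertices hM hδ hv

/-- The discrete domain of a bounded domain is finite for `δ > 0`. -/
theorem finite_embMeshDomain {Ω : Set ℂ} (hΩ : Bornology.IsBounded Ω) {δ : ℝ} (hδ : 0 < δ) :
    (embMeshDomain hexGraph hexCenter Ω δ).Finite :=
  (finite_embMeshVertices hΩ hδ).subset (embMeshDomain_subset _ _ _ _)

/-- Every vertex of a walk of `Ω_δ` whose start lies in the discrete domain lies in it. -/
theorem support_subset_aux {Ω : Set ℂ} {δ : ℝ} {x v : HexVertex}
    (q : (hexDomainGraph Ω δ).Walk x v) (hx : x ∈ embMeshDomain hexGraph hexCenter Ω δ) :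
    ∀ w ∈ q.support, w ∈ embMeshDomain hexGraph hexCenter Ω δ := by
  induction q with
  | nil =>
    intro w hw
    rw [SimpleGraph.Walk.support_nil, List.mem_singleton] at hw
    subst hw
    exact hx
  | cons hadj q ih =>
    intro w hw
    rw [SimpleGraph.Walk.support_cons, List.mem_cons] at hw
    rcases hw with rfl | hw
    · exact hx
    · exact ih ((embDomainGraph_adj_iff _ _).1 hadj).2.2 w hw

/-- If `a ≠ b` are joined in `Ω_δ` then `a` is a vertex of the discrete domain. -/
theorem mem_embMeshDomain_of_walk_of_ne {Ω : Set ℂ} {δ : ℝ} {a b : HexVertex} (hab : a ≠ b)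
    (p : (hexDomainGraph Ω δ).Walk a b) : a ∈ embMeshDomain hexGraph hexCenter Ω δ := by
  cases p with
  | nil => exact absurd rfl hab
  | cons hadj _ => exact ((embDomainGraph_adj_iff _ _).1 hadj).2.1

/-- The support of a SAW with distinct endpoints lies in the discrete domain. -/
theorem support_subset_of_ne {Ω : Set ℂ} {δ : ℝ} {a b : HexVertex} (γ : HexDomainSAW Ω δ a b)
    (hab : a ≠ b) : ∀ v ∈ γ.walk.support, v ∈ embMeshDomain hexGraph hexCenter Ω δ :=
  support_subset_aux γ.walk (mem_embMeshDomain_of_walk_of_ne hab γ.walk)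

/-- **Finitely many SAWs** in a bounded domain at positive mesh. -/
theorem finite_hexDomainSAW {Ω : Set ℂ} (hΩ : Bornology.IsBounded Ω) {δ : ℝ} (hδ : 0 < δ)
    (a b : HexVertex) : Finite (HexDomainSAW Ω δ a b) := by
  classical
  by_cases hab : a = b
  · subst hab; infer_instance
  have hfin := finite_embMeshDomain (Ω := Ω) hΩ hδ
  set C : ℕ := hfin.toFinset.card + 1 with hC
  -- inject into hexagonal-lattice walks of length `< C + 1`
  let F : HexDomainSAW Ω δ a b → hexGraph.Walk a b := fun γ =>
    γ.walk.mapLe (embDomainGraph_le hexGraph hexCenter Ω δ)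
  have hF : Function.Injective F := by
    intro γ₁ γ₂ h
    have h' : γ₁.walk = γ₂.walk :=
      SimpleGraph.Walk.map_injective_of_injective (f := SimpleGraph.Hom.ofLE _)
        (fun _ _ e => e) a b h
    cases γ₁; cases γ₂; cases h'; rfl
  have hlen : ∀ γ : HexDomainSAW Ω δ a b, (F γ).length < C + 1 := by
    intro γ
    have hl : (F γ).support = γ.walk.support := SimpleGraph.Walk.support_mapLe_eq_support _ _
    have hnd : γ.walk.support.Nodup := γ.isPath.support_nodup
    have hsupp : γ.walk.support.length ≤ hfin.toFinset.card := by
      rw [← List.toFinset_card_of_nodup hnd]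
      exact Finset.card_le_card fun v hv => by
        rw [List.mem_toFinset] at hv
        exact hfin.mem_toFinset.2 (support_subset_of_ne γ hab v hv)
    have h1 : (F γ).support.length = (F γ).length + 1 := SimpleGraph.Walk.length_support _
    have h2 : (F γ).support.length = γ.walk.support.length := by rw [hl]
    rw [hC]
    omega
  let F' : HexDomainSAW Ω δ a b → (hexGraph.finsetWalkLengthLT (C + 1) a b : Set (hexGraph.Walk a b)) :=
    fun γ => ⟨F γ, by
      rw [Finset.mem_coe, SimpleGraph.mem_finsetWalkLengthLT_iff]; exact hlen γ⟩
  exact Finite.of_injective F' fun γ₁ γ₂ h => hF (congrArg Subtype.val h)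

variable {V : Type*} {G : SimpleGraph V} {emb : V → ℂ} {Ω : Set ℂ} {δ x : ℝ} {a b : V}

/-- Finitely many SAWs ⇒ finite total weight. -/
theorem embWeight_univ_ne_top [Finite (EmbDomainSAW G emb Ω δ a b)] :
    embWeight G emb Ω δ x a b univ ≠ ∞ := by
  haveI := Fintype.ofFinite (EmbDomainSAW G emb Ω δ a b)
  rw [embWeight, Measure.sum_apply _ MeasurableSet.univ, tsum_fintype]
  refine ENNReal.sum_ne_top.2 fun γ _ => ?_
  simp only [Measure.smul_apply, measure_univ, smul_eq_mul, mul_one]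
  exact ENNReal.ofReal_ne_top

/-- A joined pair of endpoints carries a SAW, hence positive total weight when `x > 0`. -/
theorem embWeight_univ_ne_zero (hx : 0 < x) (h : (embDomainGraph G emb Ω δ).Reachable a b) :
    embWeight G emb Ω δ x a b univ ≠ 0 := by
  classical
  obtain ⟨p⟩ := h
  let γ : EmbDomainSAW G emb Ω δ a b := ⟨p.bypass, p.bypass_isPath⟩
  have h1 : embWeight G emb Ω δ x a b {γ} ≤ embWeight G emb Ω δ x a b univ :=
    measure_mono (subset_univ _)
  rw [embWeight_singleton] at h1
  have h2 : 0 < ENNReal.ofReal (x ^ γ.vertexCount) := ENNReal.ofReal_pos.2 (pow_pos hx _)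
  exact (h2.trans_le h1).ne'

/-- **Honest laws are probability measures**: bounded domain, positive mesh, joined endpoints. -/
theorem isProbabilityMeasure_hexSAWLaw_of_reachable {Ω : Set ℂ} (hΩ : Bornology.IsBounded Ω)
    {δ : ℝ} (hδ : 0 < δ) {a b : HexVertex} (h : (hexDomainGraph Ω δ).Reachable a b) :
    IsProbabilityMeasure (hexSAWLaw Ω δ a b) := by
  haveI := finite_hexDomainSAW hΩ hδ a b
  exact isProbabilityMeasure_hexSAWLaw
    (embWeight_univ_ne_zero hexCriticalFugacity_pos_lt_one.1 h) embWeight_univ_ne_top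

/-- In particular the honest disc laws, `0 < δ ≤ 1/2`. -/
theorem isProbabilityMeasure_hexSAWLaw_disc {δ : ℝ} (hδ : 0 < δ) (hδ1 : δ ≤ 1 / 2) :
    IsProbabilityMeasure (hexSAWLaw 𝔻 δ (aDisc δ) (bDisc δ)) :=
  isProbabilityMeasure_hexSAWLaw_of_reachable Metric.isBounded_ball hδ
    (reachable_disc (aDisc_mem hδ hδ1) (bDisc_mem hδ hδ1))

/-- The source of every SAW curve is the rescaled first endpoint. -/
theorem curve_source (γ : EmbDomainSAW G emb Ω δ a b) : γ.curve.source = (δ : ℂ) * emb a := by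
  simp only [EmbDomainSAW.curve, CurveClass.source_mk, Curve.source]
  exact SimpleGraph.Walk.toCurve_apply_zero (fun w => (δ : ℂ) * emb w) γ.walk

end Finiteness

/-! ## §3e Three natural strengthenings of `HexTight`, each implying it, each FALSE -/

section Strengthenings

/-- S1 — the ALL-MESHES form (`IsTightLaws`: tightness of the push-forward laws over every
`δ ∈ (0, 1]`), the hexagonal twin of the refuted `SAWParafermion.Tight` (stmt-0772). -/
def HexTightAllMeshes : Prop :=
  ∀ (D : DobrushinDomain) (a b : ℝ → HexVertex), IsEmbEndpointApprox hexGraph hexCenter D a b →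
    IsTightLaws fun δ => (hexSAWLaw D.carrier δ (a δ) (b δ)).map (fun γ => γ.curve)

/-- S2 — a tightness threshold `δ₀` UNIFORM over the endpoint approximations of a domain
(quantifier swap of `SAWBetheAnsatz.HexEventualTight`, stmt-4997). -/
def HexTightUniformThreshold : Prop :=
  ∀ D : DobrushinDomain, ∃ δ₀ : ℝ, 0 < δ₀ ∧ ∀ (a b : ℝ → HexVertex),
    IsEmbEndpointApprox hexGraph hexCenter D a b →
    IsTightMeasureSet ((fun δ => (hexSAWLaw D.carrier δ (a δ) (b δ)).map (fun γ => γ.curve)) ''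
      Set.Ioc 0 δ₀)

/-- S3 — a FINITE net instead of a compact set. -/
def HexTightFiniteNet : Prop :=
  ∀ (D : DobrushinDomain) (a b : ℝ → HexVertex), IsEmbEndpointApprox hexGraph hexCenter D a b →
    ∀ ε : ℝ≥0∞, 0 < ε → ∃ K : Set (CurveClass ℂ), K.Finite ∧
      ∀ᶠ δ in 𝓝[>] (0 : ℝ), hexSAWLaw D.carrier δ (a δ) (b δ)
        ((fun γ : HexDomainSAW D.carrier δ (a δ) (b δ) => γ.curve) ⁻¹' Kᶜ) ≤ ε

theorem crux_of_allMeshes (h : HexTightAllMeshes) : Crux := fun D a b hab =>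
  isTightAlongMesh_of_isTightLaws (Eventually.of_forall fun _ => aemeasurable_embCurve _ _ _ _ _ _ _)
    (h D a b hab)

theorem crux_of_uniformThreshold (h : HexTightUniformThreshold) : Crux := fun D a b hab => by
  obtain ⟨δ₀, hδ₀, hT⟩ := h D
  exact isTightAlongMesh_of_isTightMeasureSet_image
    (Eventually.of_forall fun _ => aemeasurable_embCurve _ _ _ _ _ _ _) hδ₀ (hT a b hab)

theorem crux_of_finiteNet (h : HexTightFiniteNet) : Crux := fun D a b hab ε hε => by
  obtain ⟨K, hK, hev⟩ := h D a b hab ε hε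
  exact ⟨K, hK.isCompact, hev⟩

/-! ### spliced endpoint families: honest below `δ₁`, far and coincident above -/

/-- honest up to `δ₁`, far coincident on `(δ₁, ∞)` -/
def spliceA (δ₁ δ : ℝ) : HexVertex := if δ ≤ δ₁ then aDisc δ else far (δ - δ₁)

/-- honest up to `δ₁`, far coincident on `(δ₁, ∞)` -/
def spliceB (δ₁ δ : ℝ) : HexVertex := if δ ≤ δ₁ then bDisc δ else far (δ - δ₁)

theorem isEmbEndpointApprox_splice {δ₁ : ℝ} (hδ₁ : 0 < δ₁) :
    IsEmbEndpointApprox hexGraph hexCenter DobrushinDomain.unitDisc (spliceA δ₁) (spliceB δ₁) := by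
  have hev : ∀ᶠ δ : ℝ in 𝓝[>] 0, δ ≤ δ₁ := by
    filter_upwards [Ioo_mem_nhdsGT hδ₁] with δ hδ using hδ.2.le
  have hA : (fun δ : ℝ => (δ : ℂ) * hexCenter (aDisc δ)) =ᶠ[𝓝[>] 0]
      fun δ => (δ : ℂ) * hexCenter (spliceA δ₁ δ) :=
    hev.mono fun δ hδ => by simp [spliceA, hδ]
  have hB : (fun δ : ℝ => (δ : ℂ) * hexCenter (bDisc δ)) =ᶠ[𝓝[>] 0]
      fun δ => (δ : ℂ) * hexCenter (spliceB δ₁ δ) :=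
    hev.mono fun δ hδ => by simp [spliceB, hδ]
  refine ⟨?_, ?_, ?_⟩
  · filter_upwards [isEmbEndpointApprox_unitDisc.reachable, hev] with δ hr hδ
    simpa [spliceA, spliceB, hδ] using hr
  · exact isEmbEndpointApprox_unitDisc.tendsto_fst.congr' hA
  · exact isEmbEndpointApprox_unitDisc.tendsto_snd.congr' hB

/-- at equal endpoints, the law of any event containing every SAW is `1` -/
theorem hexSAWLaw_apply_eq_one_of_eq {Ω : Set ℂ} {δ : ℝ} {a b : HexVertex} (hab : a = b)
    {s : Set (HexDomainSAW Ω δ a b)} (hs : ∀ γ, γ ∈ s) : hexSAWLaw Ω δ a b s = 1 := by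
  subst hab
  exact hexSAWLaw_self_apply_of_mem (hs _)

/-- **The spliced disc laws on `(0, δ₀]` are NOT tight** whenever `δ₁ < δ₀`: just above `δ₁`
the law is a Dirac mass at a constant curve of arbitrarily large norm. -/
theorem not_isTightMeasureSet_splice {δ₁ δ₀ : ℝ} (hδ₁ : 0 < δ₁) (h10 : δ₁ < δ₀) :
    ¬ IsTightMeasureSet ((fun δ => (hexSAWLaw 𝔻 δ (spliceA δ₁ δ) (spliceB δ₁ δ)).map
      (fun γ => γ.curve)) '' Set.Ioc 0 δ₀) := by
  intro ht
  rw [isTightMeasureSet_iff_exists_isCompact_measure_compl_le] at ht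
  obtain ⟨K, hK, hμ⟩ := ht 2⁻¹ (by simp)
  obtain ⟨R, hR⟩ := (isBounded_iff_subset_closedBall 0).1
    (hK.image CurveClass.continuous_source).isBounded
  set t : ℝ := min (max R 0 + 1)⁻¹ (δ₀ - δ₁) with ht_def
  have ht0 : 0 < t := lt_min (by positivity) (by linarith)
  have htle : t ≤ δ₀ - δ₁ := min_le_right _ _
  have htR : t ≤ (max R 0 + 1)⁻¹ := min_le_left _ _
  set δ : ℝ := δ₁ + t with hδ_def
  have hδmem : δ ∈ Set.Ioc 0 δ₀ := ⟨by linarith, by linarith⟩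
  have hnot : ¬ δ ≤ δ₁ := by linarith
  have hsub : δ - δ₁ = t := by rw [hδ_def]; ring
  have hA : spliceA δ₁ δ = far t := by simp [spliceA, hnot, hsub]
  have hB : spliceB δ₁ δ = far t := by simp [spliceB, hnot, hsub]
  -- every SAW curve at mesh `δ` starts far away
  have hfar : ∀ γ : HexDomainSAW 𝔻 δ (spliceA δ₁ δ) (spliceB δ₁ δ), γ.curve ∉ K := by
    intro γ hγ
    have hs := hR (mem_image_of_mem _ hγ)
    rw [curve_source, hA, mem_closedBall, dist_zero_right] at hs
    have h1 : t⁻¹ ≤ ‖(t : ℂ) * hexCenter (far t)‖ := inv_le_norm_far ht0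
    have h2 : ‖(t : ℂ) * hexCenter (far t)‖ ≤ ‖(δ : ℂ) * hexCenter (far t)‖ := by
      rw [norm_mul, norm_mul, Complex.norm_real, Complex.norm_real, Real.norm_eq_abs,
        Real.norm_eq_abs, abs_of_pos ht0, abs_of_pos (by linarith : (0 : ℝ) < δ)]
      exact mul_le_mul_of_nonneg_right (by linarith) (norm_nonneg _)
    have h3 : max R 0 + 1 ≤ t⁻¹ := by
      rw [le_inv_comm₀ (by positivity) ht0]; exact htR
    linarith [le_max_left R 0]
  have h1 : hexSAWLaw 𝔻 δ (spliceA δ₁ δ) (spliceB δ₁ δ)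
      ((fun γ => γ.curve) ⁻¹' Kᶜ) = 1 :=
    hexSAWLaw_apply_eq_one_of_eq (hA.trans hB.symm) fun γ => hfar γ
  have hle := hμ _ (mem_image_of_mem _ hδmem)
  rw [Measure.map_apply (EmbDomainSAW.measurable_of_top _) hK.isClosed.measurableSet.compl,
    h1] at hle
  exact absurd hle (not_le.2 (ENNReal.inv_lt_one.2 ENNReal.one_lt_two))

/-- **S1 is false** (hexagonal twin of `SAWParafermionTight_refuted`). -/
theorem not_hexTightAllMeshes : ¬ HexTightAllMeshes := by
  intro h
  have h1 := h DobrushinDomain.unitDisc (spliceA (1 / 2)) (spliceB (1 / 2))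
    (isEmbEndpointApprox_splice one_half_pos)
  unfold IsTightLaws at h1
  exact not_isTightMeasureSet_splice (δ₁ := 1 / 2) (δ₀ := 1) one_half_pos one_half_lt_one h1

/-- **S2 is false**: no threshold is uniform over the endpoint approximations of the disc. -/
theorem not_hexTightUniformThreshold : ¬ HexTightUniformThreshold := by
  intro h
  obtain ⟨δ₀, hδ₀, hT⟩ := h DobrushinDomain.unitDisc
  have h1 := hT (spliceA (δ₀ / 2)) (spliceB (δ₀ / 2)) (isEmbEndpointApprox_splice (half_pos hδ₀))
  exact not_isTightMeasureSet_splice (δ₁ := δ₀ / 2) (δ₀ := δ₀) (half_pos hδ₀) (half_lt_self hδ₀) h1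

/-- a finite set of reals is eventually avoided along `𝓝[>] 0` -/
theorem eventually_not_mem_of_finite {T : Set ℝ} (hT : T.Finite) :
    ∀ᶠ δ : ℝ in 𝓝[>] 0, δ ∉ T := by
  have : ∀ τ ∈ T, ∀ᶠ δ : ℝ in 𝓝[>] 0, δ ≠ τ := by
    intro τ _
    rcases le_or_gt τ 0 with hτ | hτ
    · filter_upwards [self_mem_nhdsWithin] with δ hδ
      exact (hτ.trans_lt hδ).ne'
    · filter_upwards [Ioo_mem_nhdsGT hτ] with δ hδ
      exact hδ.2.ne
  filter_upwards [(hT.eventually_all).2 this] with δ hδ hmem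
  exact hδ δ hmem rfl

/-- **S3 is false**: along the HONEST disc approximation every SAW curve at mesh `δ` starts at
height `δ √3 / 6`, so the meshes whose curves meet a finite net are finitely many, while the laws
are probability measures. -/
theorem not_hexTightFiniteNet : ¬ HexTightFiniteNet := by
  intro h
  obtain ⟨K, hK, hev⟩ := h _ _ _ isEmbEndpointApprox_unitDisc 2⁻¹ (by simp)
  -- the finitely many meshes at which some curve of the net starts at the right height
  set T : Set ℝ := (fun z : ℂ => z.im / (Real.sqrt 3 / 6)) '' (CurveClass.source '' K)
  have hT : T.Finite := (hK.image _).image _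
  have h3 : 0 < Real.sqrt 3 / 6 := by positivity
  obtain ⟨δ, hδK, hδT, hδI⟩ := (hev.and ((eventually_not_mem_of_finite hT).and
    (Ioo_mem_nhdsGT (show (0 : ℝ) < 1 / 2 by norm_num)))).exists
  haveI := isProbabilityMeasure_hexSAWLaw_disc hδI.1 hδI.2.le
  have hfar : ∀ γ : HexDomainSAW 𝔻 δ (aDisc δ) (bDisc δ), γ.curve ∉ K := by
    intro γ hγ
    apply hδT
    refine ⟨γ.curve.source, mem_image_of_mem _ hγ, ?_⟩
    show (γ.curve.source).im / (Real.sqrt 3 / 6) = δ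
    rw [curve_source, im_aDisc]
    field_simp
  have h1 : hexSAWLaw 𝔻 δ (aDisc δ) (bDisc δ) ((fun γ => γ.curve) ⁻¹' Kᶜ) = 1 := by
    have : (fun γ : HexDomainSAW 𝔻 δ (aDisc δ) (bDisc δ) => γ.curve) ⁻¹' Kᶜ = univ :=
      eq_univ_of_forall fun γ => hfar γ
    rw [this, measure_univ]
  have hle : hexSAWLaw 𝔻 δ (aDisc δ) (bDisc δ) ((fun γ => γ.curve) ⁻¹' Kᶜ) ≤ 2⁻¹ := hδK
  rw [h1] at hle
  exact absurd hle (not_le.2 (ENNReal.inv_lt_one.2 ENNReal.one_lt_two))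

end Strengthenings



/-! ## §4 Window compactness at positive mesh, and `HexTight ↔ HexEventualTight` (stmt-4997)

At meshes `δ ∈ [δ₁, δ₀]` (with `δ₁ > 0`) ALL honest SAW curves of a bounded domain lie in ONE
compact set of `CurveClass ℂ`: they are uniform polylines with boundedly many edges of length
`≤ δ₀`, hence uniformly Lipschitz in time, hence of uniformly bounded tortuosity at every scale
(Aizenman–Burchard's compactness criterion `isCompact_closure_image_mk_of_tortuosity_le`). So the
ONLY content of the crux is at `δ → 0`, and the two filed forms of hexagonal tightness — the
along-the-mesh form `HexTight` (stmt-5423) and the set-level `∃ δ₀` form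
`SAWBetheAnsatz.HexEventualTight` (stmt-4997) — are EQUIVALENT (`hexEventualTight_iff_crux`):
one crux filed twice. -/

section Window

open Literature.Probability.Percolation
open scoped unitInterval

/-- squared distance of two face centres in the coordinates `A`, `B` -/
theorem normSq_hexCenter_sub (v w : HexVertex) : Complex.normSq (hexCenter v - hexCenter w) =
    (3 * ((cA v : ℝ) - cA w) ^ 2 + ((cB v : ℝ) - cB w) ^ 2) / 12 := by
  rw [Complex.normSq_apply, Complex.sub_re, Complex.sub_im, hexCenter_re, hexCenter_re,
    hexCenter_im, hexCenter_im]
  linear_combination (((cB v : ℝ) - cB w) ^ 2 / 36) * sqrt3_sq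

/-- adjacent faces have centres at squared distance `1/3` (honeycomb edge `1/√3`) -/
theorem normSq_hexCenter_sub_of_adj {v w : HexVertex} (h : hexGraph.Adj v w) :
    Complex.normSq (hexCenter v - hexCenter w) = 1 / 3 := by
  rw [normSq_hexCenter_sub]
  obtain ⟨x, k⟩ := v
  obtain ⟨y, l⟩ := w
  fin_cases k <;> fin_cases l
  · exact absurd h (not_hexGraph_adj_of_snd_eq_holds _ _ rfl)
  · rcases (hexGraph_adj_iff_of_snd_eq_zero_holds x y).1 h with rfl | rfl | rfl <;>
      simp [Pi.sub_apply] <;> ring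
  · rcases (hexGraph_adj_iff_of_snd_eq_one x y).1 h with rfl | rfl | rfl <;>
      simp [Pi.add_apply] <;> ring
  · exact absurd h (not_hexGraph_adj_of_snd_eq_holds _ _ rfl)

/-- adjacent faces have centres at distance `≤ 1` -/
theorem dist_hexCenter_le_one_of_adj {v w : HexVertex} (h : hexGraph.Adj v w) :
    dist (hexCenter v) (hexCenter w) ≤ 1 := by
  rw [Complex.dist_eq, ← sq_le_one_iff₀ (norm_nonneg _), Complex.sq_norm,
    normSq_hexCenter_sub_of_adj h]
  norm_num

/-- rescaled adjacent centres are `δ₀`-close for `0 < δ ≤ δ₀` -/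
theorem dist_smul_hexCenter_le_of_adj {δ δ₀ : ℝ} (hδ : 0 < δ) (hδ₀ : δ ≤ δ₀) {v w : HexVertex}
    (h : hexGraph.Adj v w) : dist ((δ : ℂ) * hexCenter v) ((δ : ℂ) * hexCenter w) ≤ δ₀ := by
  rw [Complex.dist_eq, ← mul_sub, norm_mul, Complex.norm_real, Real.norm_eq_abs, abs_of_pos hδ,
    ← Complex.dist_eq]
  calc δ * dist (hexCenter v) (hexCenter w) ≤ δ * 1 :=
        mul_le_mul_of_nonneg_left (dist_hexCenter_le_one_of_adj h) hδ.le
    _ ≤ δ₀ := by linarith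

/-! ### Lipschitz curves have bounded tortuosity -/

/-- the grid point `min (j/M) 1` of the unit interval -/
def gridPt (M j : ℕ) : I :=
  ⟨min ((j : ℝ) / M) 1, le_min (by positivity) zero_le_one, min_le_right _ _⟩

theorem coe_gridPt_of_le {M j : ℕ} (hM : 0 < M) (hj : j ≤ M) : (gridPt M j : ℝ) = j / M := by
  show min ((j : ℝ) / M) 1 = j / M
  exact min_eq_left (by rw [div_le_one (Nat.cast_pos.2 hM)]; exact_mod_cast hj)

theorem gridPt_zero (M : ℕ) : gridPt M 0 = 0 := Subtype.ext (by simp [gridPt])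

theorem gridPt_self {M : ℕ} (hM : 0 < M) : gridPt M M = 1 :=
  Subtype.ext (by rw [coe_gridPt_of_le hM le_rfl, div_self (Nat.cast_pos.2 hM).ne']; rfl)

/-- **A curve which is `K`-Lipschitz in time has tortuosity `≤ ⌈K/ℓ⌉ + 1` at scale `ℓ`**: the
grid `{j/M}`, `M = ⌈K/ℓ⌉ + 1`, is a division of size `ℓ`. -/
theorem tortuosity_le_of_lipschitz {E : Type*} [PseudoMetricSpace E] (γ : Curve E) {K : ℝ}
    (hK : 0 ≤ K) (hγ : ∀ t t' : I, t ≤ t' → dist (γ t) (γ t') ≤ K * ((t' : ℝ) - t))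
    {ℓ : ℝ} (hℓ : 0 < ℓ) : γ.tortuosity ℓ ≤ ⌈K / ℓ⌉₊ + 1 := by
  classical
  set M : ℕ := ⌈K / ℓ⌉₊ + 1 with hM
  have hM0 : 0 < M := Nat.succ_pos _
  have hMr : (0 : ℝ) < M := Nat.cast_pos.2 hM0
  have hKM : K / M ≤ ℓ := by
    have h1 : K / ℓ ≤ (⌈K / ℓ⌉₊ : ℝ) := Nat.le_ceil _
    have h2 : K / ℓ ≤ M := by rw [hM]; push_cast; linarith
    rw [div_le_iff₀ hℓ] at h2
    rw [div_le_iff₀ hMr]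
    linarith
  set P : Finset I := (Finset.range (M + 1)).image (gridPt M) with hP
  have hdiv : γ.IsDivision ℓ P := by
    refine ⟨?_, ?_, ?_⟩
    · exact Finset.mem_image.2 ⟨0, by simp, gridPt_zero M⟩
    · exact Finset.mem_image.2 ⟨M, by simp, gridPt_self hM0⟩
    · intro s u hsu hPsu
      have hs0 : 0 ≤ (s : ℝ) := s.2.1
      have hu1 : (u : ℝ) ≤ 1 := u.2.2
      have hsu' : (s : ℝ) ≤ u := hsu
      set j : ℕ := ⌊(s : ℝ) * M⌋₊ with hj
      have hjs : (j : ℝ) ≤ s * M := Nat.floor_le (by positivity)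
      have hsj : (s : ℝ) * M < j + 1 := Nat.lt_floor_add_one _
      have hu : (u : ℝ) * M ≤ j + 1 := by
        by_contra hcon
        push Not at hcon
        have hj1M : j + 1 ≤ M := by
          have h1 : ((j : ℝ) + 1) < M := by nlinarith
          have h2 : (((j + 1 : ℕ) : ℝ)) < M := by push_cast; exact h1
          exact (Nat.cast_lt.1 h2).le
        have hp : gridPt M (j + 1) ∈ P :=
          Finset.mem_image.2 ⟨j + 1, by simp; omega, rfl⟩
        have hcoe : (gridPt M (j + 1) : ℝ) = ((j : ℝ) + 1) / M := by
          rw [coe_gridPt_of_le hM0 hj1M]; push_cast; ring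
        rcases hPsu _ hp with h | h
        · have h' : ((j : ℝ) + 1) / M ≤ s := by rw [← hcoe]; exact h
          rw [div_le_iff₀ hMr] at h'
          linarith
        · have h' : (u : ℝ) ≤ ((j : ℝ) + 1) / M := by rw [← hcoe]; exact h
          rw [le_div_iff₀ hMr] at h'
          linarith
      have hus : ((u : ℝ) - s) ≤ 1 / M := by
        rw [le_div_iff₀ hMr]
        nlinarith
      calc dist (γ s) (γ u) ≤ K * ((u : ℝ) - s) := hγ s u hsu
        _ ≤ K * (1 / M) := mul_le_mul_of_nonneg_left hus hK
        _ = K / M := by ring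
        _ ≤ ℓ := hKM
  have hlt := hdiv.tortuosity_lt_card
  have hcard : P.card ≤ M + 1 := Finset.card_image_le.trans (by simp)
  omega

/-! ### The window compactness -/

/-- the vertex list of a SAW is the rescaled first endpoint followed by the rest -/
theorem support_map_eq_cons {Ω : Set ℂ} {δ : ℝ} {a b : HexVertex} (γ : HexDomainSAW Ω δ a b) :
    γ.walk.support.map (fun w => (δ : ℂ) * hexCenter w) =
      ((δ : ℂ) * hexCenter a) :: (γ.walk.support.tail.map fun w => (δ : ℂ) * hexCenter w) := by
  conv_lhs => rw [← SimpleGraph.Walk.cons_tail_support]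
  rfl

/-- the rescaled vertex list of a SAW of `Ω_δ`, `0 < δ ≤ δ₀`, has consecutive points `δ₀`-close -/
theorem edgesLE_support_map {Ω : Set ℂ} {δ δ₀ : ℝ} (hδ : 0 < δ) (hδ₀ : δ ≤ δ₀) {a b : HexVertex}
    (γ : HexDomainSAW Ω δ a b) :
    EdgesLE δ₀ (γ.walk.support.map fun w => (δ : ℂ) * hexCenter w) :=
  List.isChain_map_of_isChain (fun w => (δ : ℂ) * hexCenter w)
    (fun v w (h : (hexDomainGraph Ω δ).Adj v w) =>
      dist_smul_hexCenter_le_of_adj hδ hδ₀ (embDomainGraph_le _ _ _ _ h))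
    γ.walk.isChain_adj_support

/-- **Window compactness.** For a bounded `Ω` and a window of meshes `[δ₁, δ₀]`, `δ₁ > 0`, ONE
compact subset of `CurveClass ℂ` contains the curve of every SAW of every `Ω_δ`, `δ` in the
window, whose first endpoint is a vertex of `Ω_δ`. -/
theorem window_compact {Ω : Set ℂ} (hΩ : Bornology.IsBounded Ω) {δ₁ δ₀ : ℝ} (hδ₁ : 0 < δ₁)
    (h10 : δ₁ ≤ δ₀) :
    ∃ 𝒦 : Set (CurveClass ℂ), IsCompact 𝒦 ∧ ∀ δ ∈ Set.Icc δ₁ δ₀, ∀ (a b : HexVertex),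
      a ∈ embMeshDomain hexGraph hexCenter Ω δ → ∀ γ : HexDomainSAW Ω δ a b, γ.curve ∈ 𝒦 := by
  classical
  obtain ⟨R, hR⟩ := hΩ.subset_closedBall 0
  have hR' : Ω ⊆ closedBall 0 |R| := hR.trans (closedBall_subset_closedBall (le_abs_self R))
  have hfin : {v : HexVertex | ‖hexCenter v‖ ≤ |R| / δ₁}.Finite := finite_norm_hexCenter_le _
  set C : ℕ := hfin.toFinset.card with hC
  set Lsc : ℕ → ℝ := fun n => 1 / ((n : ℝ) + 1) with hLsc
  set Φ : ℕ → ℕ := fun n => ⌈δ₀ * C / Lsc n⌉₊ + 1 with hΦ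
  have hδ₀ : 0 < δ₀ := hδ₁.trans_le h10
  refine ⟨closure (CurveClass.mk '' {γ : Curve ℂ | γ.range ⊆ closedBall 0 |R| ∧
      ∀ n, γ.tortuosity (Lsc n) ≤ Φ n}),
    CurveClass.isCompact_closure_image_mk_of_tortuosity_le (isCompact_closedBall _ _) Lsc Φ ?_, ?_⟩
  · intro η hη
    obtain ⟨n, hn⟩ := exists_nat_one_div_lt hη
    exact ⟨n, by positivity, hn.le⟩
  · intro δ hδ a b ha γ
    apply subset_closure
    have hδpos : 0 < δ := hδ₁.trans_le hδ.1
    set rest : List ℂ := γ.walk.support.tail.map fun w => (δ : ℂ) * hexCenter w with hrest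
    have hLv : γ.walk.support.map (fun w => (δ : ℂ) * hexCenter w) =
        ((δ : ℂ) * hexCenter a) :: rest := support_map_eq_cons γ
    have hcurve : γ.curve = CurveClass.mk (uniformCurve (((δ : ℂ) * hexCenter a) :: rest)) := by
      rw [← hLv]
      exact mk_polyline_eq_mk_uniformCurve _
    refine ⟨uniformCurve (((δ : ℂ) * hexCenter a) :: rest), ⟨?_, fun n => ?_⟩, hcurve.symm⟩
    · -- the trace: that of the SAW curve, inside `closure Ω ⊆ closedBall 0 |R|`
      have h1 : (uniformCurve (((δ : ℂ) * hexCenter a) :: rest)).range = γ.curve.range := by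
        rw [hcurve, CurveClass.range_mk]
      rw [h1]
      exact (curve_range_subset_closure γ (mem_closure_of_mem_embMeshDomain ha)).trans
        (closure_minimal hR' isClosed_closedBall)
    · -- tortuosity: Lipschitz constant `δ₀ · #edges ≤ δ₀ · C`
      have hedges : EdgesLE δ₀ (((δ : ℂ) * hexCenter a) :: rest) := by
        rw [← hLv]; exact edgesLE_support_map hδpos hδ.2 γ
      have hlen : rest.length ≤ C := by
        rw [hrest, List.length_map, List.length_tail]
        have hnd : γ.walk.support.Nodup := γ.isPath.support_nodup
        have hsupp : γ.walk.support.length ≤ C := by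
          rw [← List.toFinset_card_of_nodup hnd, hC]
          refine Finset.card_le_card fun v hv => ?_
          rw [List.mem_toFinset] at hv
          rw [Set.Finite.mem_toFinset]
          show ‖hexCenter v‖ ≤ |R| / δ₁
          by_cases hab : a = b
          · subst hab
            have : v = a := by
              have := (SimpleGraph.Walk.isPath_iff_nil.1 γ.isPath)
              rw [SimpleGraph.Walk.nil_iff_support_eq] at this
              rw [this, List.mem_singleton] at hv
              exact hv
            subst this
            exact (norm_hexCenter_le_of_mem_embMeshVertices hR' hδpos
              (embMeshDomain_subset _ _ _ _ ha)).trans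
              (div_le_div_of_nonneg_left (abs_nonneg R) hδ₁ hδ.1)
          · exact (norm_hexCenter_le_of_mem_embMeshVertices hR' hδpos
              (embMeshDomain_subset _ _ _ _ (support_subset_of_ne γ hab v hv))).trans
              (div_le_div_of_nonneg_left (abs_nonneg R) hδ₁ hδ.1)
        omega
      have hlip : ∀ t t' : I, t ≤ t' →
          dist (uniformCurve (((δ : ℂ) * hexCenter a) :: rest) t)
            (uniformCurve (((δ : ℂ) * hexCenter a) :: rest) t') ≤ δ₀ * C * ((t' : ℝ) - t) := by
        intro t t' htt'
        refine (dist_uniformCurve_apply_le hedges htt').trans ?_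
        have : (t : ℝ) ≤ t' := htt'
        have hl : (rest.length : ℝ) ≤ C := by exact_mod_cast hlen
        exact mul_le_mul_of_nonneg_right (mul_le_mul_of_nonneg_left hl hδ₀.le) (sub_nonneg.2 this)
      refine (tortuosity_le_of_lipschitz _ (by positivity) hlip (by positivity)).trans ?_
      simp only [hΦ]
      rfl

end Window

/-! ### The equivalence with `SAWBetheAnsatz.HexEventualTight` (stmt-CriticalPhenomena-4997) -/

section Equivalence

/-- honest endpoints, eventually: distinct and joined -/
theorem eventually_ne_and_reachable {D : DobrushinDomain} {a b : ℝ → HexVertex}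
    (hab : IsEmbEndpointApprox hexGraph hexCenter D a b) :
    ∀ᶠ δ : ℝ in 𝓝[>] 0, a δ ≠ b δ ∧ (hexDomainGraph D.carrier δ).Reachable (a δ) (b δ) := by
  have hd : D.pt 0 ≠ D.pt 1 := fun e => absurd (D.pt_injective e) (by decide)
  obtain ⟨U, W, hU, hW, h0U, h1W, hUW⟩ := t2_separation hd
  have ha : ∀ᶠ δ : ℝ in 𝓝[>] 0, (δ : ℂ) * hexCenter (a δ) ∈ U :=
    hab.tendsto_fst (hU.mem_nhds h0U)
  have hb : ∀ᶠ δ : ℝ in 𝓝[>] 0, (δ : ℂ) * hexCenter (b δ) ∈ W :=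
    hab.tendsto_snd (hW.mem_nhds h1W)
  filter_upwards [ha, hb, hab.reachable] with δ haU hbW hr
  refine ⟨?_, hr⟩
  intro heq
  rw [heq] at haU
  exact Set.disjoint_left.1 hUW haU hbW

/-- **`HexTight` (stmt-5423) ↔ `HexEventualTight` (stmt-4997).** `←`: the tree bridge
`isTightAlongMesh_of_isTightMeasureSet_image`. `→`: choose `δ₀` inside the honest window; given
`ε`, `HexTight` supplies a compact `K` good below some `δ_ε`, and window compactness a compact `𝒦`
containing EVERY curve at meshes `[δ_ε/2 ∧ δ₀, δ₀]`; `K ∪ 𝒦` works on all of `(0, δ₀]`. -/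
theorem hexEventualTight_iff_crux :
    Summit.CriticalPhenomena.SAWScalingLimit.Theses.SAWBetheAnsatz.HexEventualTight ↔ Crux := by
  constructor
  · intro h D a b hab
    obtain ⟨δ₀, hδ₀, hT⟩ := h D a b hab
    exact isTightAlongMesh_of_isTightMeasureSet_image
      (Eventually.of_forall fun _ => aemeasurable_embCurve _ _ _ _ _ _ _) hδ₀ hT
  · intro h D a b hab
    obtain ⟨δ₀', hδ₀', hhon⟩ := mem_nhdsGT_iff_exists_Ioo_subset.1 (eventually_ne_and_reachable hab)
    have hδ₀'pos : 0 < δ₀' := hδ₀'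
    set δ₀ : ℝ := δ₀' / 2 with hδ₀_def
    have hδ₀ : 0 < δ₀ := by positivity
    refine ⟨δ₀, hδ₀, ?_⟩
    rw [isTightMeasureSet_iff_exists_isCompact_measure_compl_le]
    intro ε hε
    obtain ⟨K, hK, hevK⟩ := h D a b hab ε hε
    obtain ⟨δε, hδεpos, hδε⟩ := mem_nhdsGT_iff_exists_Ioo_subset.1 hevK
    have hδεpos' : 0 < δε := hδεpos
    set δ₁ : ℝ := min (δε / 2) δ₀ with hδ₁_def
    have hδ₁ : 0 < δ₁ := lt_min (by positivity) hδ₀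
    have h10 : δ₁ ≤ δ₀ := min_le_right _ _
    obtain ⟨𝒦, h𝒦, hwin⟩ := window_compact D.isBounded hδ₁ h10
    refine ⟨K ∪ 𝒦, hK.union h𝒦, ?_⟩
    rintro μ ⟨δ, hδ, rfl⟩
    rw [Measure.map_apply (EmbDomainSAW.measurable_of_top _)
      (hK.union h𝒦).isClosed.measurableSet.compl]
    by_cases hlt : δ < δε
    · calc hexSAWLaw D.carrier δ (a δ) (b δ) ((fun γ => γ.curve) ⁻¹' (K ∪ 𝒦)ᶜ)
          ≤ hexSAWLaw D.carrier δ (a δ) (b δ) ((fun γ => γ.curve) ⁻¹' Kᶜ) :=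
            measure_mono (preimage_mono (compl_subset_compl.2 subset_union_left))
        _ ≤ ε := hδε ⟨hδ.1, hlt⟩
    · have hδ1 : δ₁ ≤ δ := by
        have : δ₁ ≤ δε / 2 := min_le_left _ _
        linarith [not_lt.1 hlt]
      have hhon' := hhon ⟨hδ.1, by rw [hδ₀_def] at hδ; linarith [hδ.2]⟩
      have ha : a δ ∈ embMeshDomain hexGraph hexCenter D.carrier δ :=
        mem_embMeshDomain_of_reachable_of_ne hhon'.1 hhon'.2
      have hempty : (fun γ : HexDomainSAW D.carrier δ (a δ) (b δ) => γ.curve) ⁻¹' (K ∪ 𝒦)ᶜ = ∅ :=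
        eq_empty_of_forall_notMem fun γ hγ => hγ (Or.inr (hwin δ ⟨hδ1, hδ.2⟩ _ _ ha γ))
      rw [hempty, measure_empty]
      exact bot_le

/-- the same, stated against the crux name of route SAWDevelopingMap -/
theorem crux_iff_hexEventualTight :
    Crux ↔ Summit.CriticalPhenomena.SAWScalingLimit.Theses.SAWBetheAnsatz.HexEventualTight :=
  hexEventualTight_iff_crux.symm

end Equivalence

/-! ## §5 Appendix — the `δℤ²` twins: `EventualTight` stmt-1881 (along the mesh) ↔ stmt-1372 / 4922 (`∃ δ₀`)

The sub-problem files TWO square-lattice tightness cruxes of the same two shapes: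
`SAWAsymptoticMorera.EventualTight` (stmt-1881, `IsTightAlongMesh`; shared by SAWConfRestriction,
SAWExcursionCardy, SAWLaplacianWalk, SAWLeftRightFKG, SAWImaginaryGeometry, SAWExpectedSignature…)
and `SAWEdgeOfPositiveType.EventualTight` (stmt-1372) = `SAWChargeContinuation.EventualTight`
(stmt-4922) (`∃ δ₀ > 0, IsTightMeasureSet (laws '' Ioc 0 δ₀)`; shared by SAWFrontierHomotopy,
SAWWeldingIdentification…). The `δℤ²` port of §2b + §4 proves them EQUIVALENT
(`z2_setForm_iff_alongMesh`, `z2_chargeContinuation_iff_setForm`): one crux filed thrice. -/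

section Z2Twins

open Literature.Probability.Percolation
open scoped unitInterval

variable {Ω : Set ℂ} {δ : ℝ}

/-- darts of `Ω_δ ⊆ δℤ²` have their segment in `closure Ω` -/
theorem z2_segment_subset_closure_of_adj {x y : Site 2} (h : (discreteDomainGraph Ω δ).Adj x y) :
    segment ℝ (meshPoint δ x) (meshPoint δ y) ⊆ closure Ω :=
  (meshGraph_adj_iff.1 (discreteDomainGraph_adj_iff.1 h).1).2

/-- confinement on `δℤ²` -/
theorem z2_curve_range_subset_closure {a b : Site 2} (γ : DomainSAW Ω δ a b)
    (ha : meshPoint δ a ∈ closure Ω) : γ.curve.range ⊆ closure Ω := by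
  simp only [DomainSAW.curve, CurveClass.range_mk]
  exact range_toCurve_subset_of_darts (meshPoint δ) γ.walk ha
    fun d _ => z2_segment_subset_closure_of_adj d.adj

theorem z2_mem_meshDomain_of_reachable_of_ne {a b : Site 2} (hab : a ≠ b)
    (h : (discreteDomainGraph Ω δ).Reachable a b) : a ∈ meshDomain Ω δ := by
  obtain ⟨p⟩ := h
  cases p with
  | nil => exact absurd rfl hab
  | cons hadj _ => exact (discreteDomainGraph_adj_iff.1 hadj).2.1

theorem z2_support_subset_aux {x v : Site 2} (q : (discreteDomainGraph Ω δ).Walk x v)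
    (hx : x ∈ meshDomain Ω δ) : ∀ w ∈ q.support, w ∈ meshDomain Ω δ := by
  induction q with
  | nil =>
    intro w hw
    rw [SimpleGraph.Walk.support_nil, List.mem_singleton] at hw
    subst hw
    exact hx
  | cons hadj q ih =>
    intro w hw
    rw [SimpleGraph.Walk.support_cons, List.mem_cons] at hw
    rcases hw with rfl | hw
    · exact hx
    · exact ih (discreteDomainGraph_adj_iff.1 hadj).2.2 w hw

/-- unit steps of `δℤ²` have length `δ` -/
theorem normSq_meshPoint_sub_of_adj {x y : Site 2} (h : (zdGraph 2).Adj x y) (δ : ℝ) :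
    Complex.normSq (meshPoint δ x - meshPoint δ y) = δ ^ 2 := by
  rw [Complex.normSq_apply, Complex.sub_re, Complex.sub_im, meshPoint_re, meshPoint_re,
    meshPoint_im, meshPoint_im]
  rcases (zdGraph_adj_iff x y).1 h with ⟨i, rfl | rfl⟩ <;> fin_cases i <;> simp <;> ring

theorem dist_meshPoint_le_of_adj {δ₀ : ℝ} (hδ : 0 < δ) (hδ₀ : δ ≤ δ₀) {x y : Site 2}
    (h : (zdGraph 2).Adj x y) : dist (meshPoint δ x) (meshPoint δ y) ≤ δ₀ := by
  have h1 : ‖meshPoint δ x - meshPoint δ y‖ ^ 2 = δ ^ 2 := by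
    rw [Complex.sq_norm, normSq_meshPoint_sub_of_adj h]
  have h2 : ‖meshPoint δ x - meshPoint δ y‖ = δ := (sq_eq_sq₀ (norm_nonneg _) hδ.le).1 h1
  rw [Complex.dist_eq, h2]
  exact hδ₀

theorem z2_edgesLE_support_map {δ₀ : ℝ} (hδ : 0 < δ) (hδ₀ : δ ≤ δ₀) {a b : Site 2}
    (γ : DomainSAW Ω δ a b) : EdgesLE δ₀ (γ.walk.support.map (meshPoint δ)) :=
  List.isChain_map_of_isChain (meshPoint δ)
    (fun v w (h : (discreteDomainGraph Ω δ).Adj v w) =>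
      dist_meshPoint_le_of_adj hδ hδ₀ (meshGraph_le_zdGraph _ _ (discreteDomainGraph_adj_iff.1 h).1))
    γ.walk.isChain_adj_support

/-- a site whose `δ`-mesh point lies in `closedBall 0 R`, `δ₁ ≤ δ`, has its `δ₁`-mesh point there -/
theorem mem_meshVertices_closedBall_of_le {R δ₁ : ℝ} (hδ₁ : 0 < δ₁) (h : δ₁ ≤ δ)
    {v : Site 2} (hv : meshPoint δ v ∈ closedBall (0 : ℂ) R) :
    v ∈ meshVertices (closedBall (0 : ℂ) R) δ₁ := by
  rw [mem_meshVertices_iff]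
  rw [mem_closedBall, dist_zero_right] at hv ⊢
  have hδ : 0 < δ := hδ₁.trans_le h
  rw [meshPoint, norm_mul, Complex.norm_real, Real.norm_eq_abs, abs_of_pos hδ] at hv
  rw [meshPoint, norm_mul, Complex.norm_real, Real.norm_eq_abs, abs_of_pos hδ₁]
  have : δ₁ * ‖Site.toComplex v‖ ≤ δ * ‖Site.toComplex v‖ :=
    mul_le_mul_of_nonneg_right h (norm_nonneg _)
  linarith

/-- **Window compactness on `δℤ²`.** -/
theorem z2_window_compact (hΩ : Bornology.IsBounded Ω) {δ₁ δ₀ : ℝ} (hδ₁ : 0 < δ₁) (h10 : δ₁ ≤ δ₀) :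
    ∃ 𝒦 : Set (CurveClass ℂ), IsCompact 𝒦 ∧ ∀ δ ∈ Set.Icc δ₁ δ₀, ∀ (a b : Site 2),
      a ∈ meshDomain Ω δ → ∀ γ : DomainSAW Ω δ a b, γ.curve ∈ 𝒦 := by
  classical
  obtain ⟨R, hR⟩ := hΩ.subset_closedBall 0
  have hR' : Ω ⊆ closedBall 0 |R| := hR.trans (closedBall_subset_closedBall (le_abs_self R))
  have hfin : (meshVertices (closedBall (0 : ℂ) |R|) δ₁).Finite :=
    meshVertices_finite isBounded_closedBall hδ₁
  set C : ℕ := hfin.toFinset.card with hC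
  set Lsc : ℕ → ℝ := fun n => 1 / ((n : ℝ) + 1) with hLsc
  set Φ : ℕ → ℕ := fun n => ⌈δ₀ * C / Lsc n⌉₊ + 1 with hΦ
  have hδ₀ : 0 < δ₀ := hδ₁.trans_le h10
  refine ⟨closure (CurveClass.mk '' {γ : Curve ℂ | γ.range ⊆ closedBall 0 |R| ∧
      ∀ n, γ.tortuosity (Lsc n) ≤ Φ n}),
    CurveClass.isCompact_closure_image_mk_of_tortuosity_le (isCompact_closedBall _ _) Lsc Φ ?_, ?_⟩
  · intro η hη
    obtain ⟨n, hn⟩ := exists_nat_one_div_lt hη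
    exact ⟨n, by positivity, hn.le⟩
  · intro δ hδ a b ha γ
    apply subset_closure
    have hδpos : 0 < δ := hδ₁.trans_le hδ.1
    set rest : List ℂ := γ.walk.support.tail.map (meshPoint δ) with hrest
    have hLv : γ.walk.support.map (meshPoint δ) = meshPoint δ a :: rest := by
      conv_lhs => rw [← SimpleGraph.Walk.cons_tail_support]
      rfl
    have hcurve : γ.curve = CurveClass.mk (uniformCurve (meshPoint δ a :: rest)) := by
      rw [← hLv]
      exact mk_polyline_eq_mk_uniformCurve _
    refine ⟨uniformCurve (meshPoint δ a :: rest), ⟨?_, fun n => ?_⟩, hcurve.symm⟩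
    · have h1 : (uniformCurve (meshPoint δ a :: rest)).range = γ.curve.range := by
        rw [hcurve, CurveClass.range_mk]
      rw [h1]
      exact (z2_curve_range_subset_closure γ
        (subset_closure (meshDomain_subset_meshVertices _ _ ha))).trans
        (closure_minimal hR' isClosed_closedBall)
    · have hedges : EdgesLE δ₀ (meshPoint δ a :: rest) := by
        rw [← hLv]; exact z2_edgesLE_support_map hδpos hδ.2 γ
      have hlen : rest.length ≤ C := by
        rw [hrest, List.length_map, List.length_tail]
        have hnd : γ.walk.support.Nodup := γ.isPath.support_nodup
        have hmemv : ∀ v ∈ γ.walk.support, v ∈ meshDomain Ω δ :=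
          z2_support_subset_aux γ.walk ha
        have hsupp : γ.walk.support.length ≤ C := by
          rw [← List.toFinset_card_of_nodup hnd, hC]
          refine Finset.card_le_card fun v hv => ?_
          rw [List.mem_toFinset] at hv
          rw [Set.Finite.mem_toFinset]
          exact mem_meshVertices_closedBall_of_le hδ₁ hδ.1
            (hR' (meshDomain_subset_meshVertices _ _ (hmemv v hv)))
        omega
      have hlip : ∀ t t' : I, t ≤ t' →
          dist (uniformCurve (meshPoint δ a :: rest) t) (uniformCurve (meshPoint δ a :: rest) t')
            ≤ δ₀ * C * ((t' : ℝ) - t) := by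
        intro t t' htt'
        refine (dist_uniformCurve_apply_le hedges htt').trans ?_
        have : (t : ℝ) ≤ t' := htt'
        have hl : (rest.length : ℝ) ≤ C := by exact_mod_cast hlen
        exact mul_le_mul_of_nonneg_right (mul_le_mul_of_nonneg_left hl hδ₀.le) (sub_nonneg.2 this)
      refine (tortuosity_le_of_lipschitz _ (by positivity) hlip (by positivity)).trans ?_
      simp only [hΦ]
      rfl

/-- honest endpoints on `δℤ²`, eventually: distinct and joined -/
theorem z2_eventually_ne_and_reachable {D : DobrushinDomain} {a b : ℝ → Site 2}
    (hab : IsEndpointApprox D a b) :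
    ∀ᶠ δ : ℝ in 𝓝[>] 0, a δ ≠ b δ ∧ (discreteDomainGraph D.carrier δ).Reachable (a δ) (b δ) := by
  have hd : D.pt 0 ≠ D.pt 1 := fun e => absurd (D.pt_injective e) (by decide)
  obtain ⟨U, W, hU, hW, h0U, h1W, hUW⟩ := t2_separation hd
  have ha : ∀ᶠ δ : ℝ in 𝓝[>] 0, meshPoint δ (a δ) ∈ U := hab.tendsto_fst (hU.mem_nhds h0U)
  have hb : ∀ᶠ δ : ℝ in 𝓝[>] 0, meshPoint δ (b δ) ∈ W := hab.tendsto_snd (hW.mem_nhds h1W)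
  filter_upwards [ha, hb, hab.reachable] with δ haU hbW hr
  refine ⟨?_, hr⟩
  intro heq
  rw [heq] at haU
  exact Set.disjoint_left.1 hUW haU hbW

/-- **stmt-1372 ↔ stmt-1881**: the `∃ δ₀` set-level form and the along-the-mesh form of square-lattice
SAW tightness are equivalent (same proof as `hexEventualTight_iff_crux`). -/
theorem z2_setForm_iff_alongMesh :
    Summit.CriticalPhenomena.SAWScalingLimit.Theses.SAWEdgeOfPositiveType.EventualTight ↔
      Summit.CriticalPhenomena.SAWScalingLimit.Theses.SAWAsymptoticMorera.EventualTight := by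
  constructor
  · intro h D a b hab
    obtain ⟨δ₀, hδ₀, hT⟩ := h D a b hab
    exact isTightAlongMesh_of_isTightMeasureSet_image
      (Eventually.of_forall fun _ => aemeasurable_curve _ _ _ _) hδ₀ hT
  · intro h D a b hab
    obtain ⟨δ₀', hδ₀', hhon⟩ :=
      mem_nhdsGT_iff_exists_Ioo_subset.1 (z2_eventually_ne_and_reachable hab)
    have hδ₀'pos : 0 < δ₀' := hδ₀'
    set δ₀ : ℝ := δ₀' / 2 with hδ₀_def
    have hδ₀ : 0 < δ₀ := by positivity
    refine ⟨δ₀, hδ₀, ?_⟩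
    rw [isTightMeasureSet_iff_exists_isCompact_measure_compl_le]
    intro ε hε
    obtain ⟨K, hK, hevK⟩ := h D a b hab ε hε
    obtain ⟨δε, hδεpos, hδε⟩ := mem_nhdsGT_iff_exists_Ioo_subset.1 hevK
    have hδεpos' : 0 < δε := hδεpos
    set δ₁ : ℝ := min (δε / 2) δ₀ with hδ₁_def
    have hδ₁ : 0 < δ₁ := lt_min (by positivity) hδ₀
    have h10 : δ₁ ≤ δ₀ := min_le_right _ _
    obtain ⟨𝒦, h𝒦, hwin⟩ := z2_window_compact D.isBounded hδ₁ h10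
    refine ⟨K ∪ 𝒦, hK.union h𝒦, ?_⟩
    rintro μ ⟨δ, hδ, rfl⟩
    rw [Measure.map_apply (DomainSAW.measurable_of_top _)
      (hK.union h𝒦).isClosed.measurableSet.compl]
    by_cases hlt : δ < δε
    · calc law D.carrier δ (a δ) (b δ) ((fun γ => γ.curve) ⁻¹' (K ∪ 𝒦)ᶜ)
          ≤ law D.carrier δ (a δ) (b δ) ((fun γ => γ.curve) ⁻¹' Kᶜ) :=
            measure_mono (preimage_mono (compl_subset_compl.2 subset_union_left))
        _ ≤ ε := hδε ⟨hδ.1, hlt⟩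
    · have hδ1 : δ₁ ≤ δ := by
        have : δ₁ ≤ δε / 2 := min_le_left _ _
        linarith [not_lt.1 hlt]
      have hhon' := hhon ⟨hδ.1, by rw [hδ₀_def] at hδ; linarith [hδ.2]⟩
      have ha : a δ ∈ meshDomain D.carrier δ :=
        z2_mem_meshDomain_of_reachable_of_ne hhon'.1 hhon'.2
      have hempty : (fun γ : DomainSAW D.carrier δ (a δ) (b δ) => γ.curve) ⁻¹' (K ∪ 𝒦)ᶜ = ∅ :=
        eq_empty_of_forall_notMem fun γ hγ => hγ (Or.inr (hwin δ ⟨hδ1, hδ.2⟩ _ _ ha γ))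
      rw [hempty, measure_empty]
      exact bot_le

/-- stmt-4922 and stmt-1372 are syntactically the same statement (`∃ δ₀ > 0, …`). -/
theorem z2_chargeContinuation_iff_setForm :
    Summit.CriticalPhenomena.SAWScalingLimit.Theses.SAWChargeContinuation.EventualTight ↔
      Summit.CriticalPhenomena.SAWScalingLimit.Theses.SAWEdgeOfPositiveType.EventualTight :=
  Iff.rfl

end Z2Twins

/-! ## §6 What would suffice: the Aizenman–Burchard rung, with the short-distance cutoff (H0) discharged

`crux_of_traversalBound`: the crux follows from AB99's hypothesis (H1) for the critical hexagonal
SAW — a power bound `K (ρ/R)^λ`, `λ > 2`, on the probability of `k(x, ρ, R)` separate traversals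
of the shell `D(x; ρ, R)`, `δ ≤ ρ < R ≤ 1`, for small meshes, with a SHELL-DEPENDENT deterministic
threshold `k` (a constant threshold is false near rough marked points, cf. the docstring of
`Percolation/InterfaceScalingLimitProofs.lean`) — by the tree's criterion
`isTightMeasureSet_of_traversalBounds`. Its other hypothesis, the short-distance cutoff (H0: no
shell of inner radius `ρ ≤ δ` is traversed `hexCutoff` times), is PROVED here for every SAW
polyline (`not_hasTraversals_sawCurve`): a SAW visits each of the `≤ 338` faces near a small ball
at most once. So `HexTraversalBound` below is EXACTLY what is left of the crux. -/

section ABRung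

open Literature.Probability.Percolation
open scoped unitInterval

-- Membership in the concrete 338-element `Finset` `faceBox` makes `isDefEq` unfold it lazily:
-- a finite but deep recursion (diagnosed in scratch T8.lean: `maxRecDepth 20000` suffices).
set_option maxRecDepth 100000

variable {Ω : Set ℂ} {δ : ℝ} {a b : HexVertex}

/-- the SAW as a parametrised curve (the class of which is `γ.curve`) -/
def sawCurve (γ : HexDomainSAW Ω δ a b) : Curve ℂ := ⟨γ.walk.toCurve fun w => (δ : ℂ) * hexCenter w⟩

theorem mk_sawCurve (γ : HexDomainSAW Ω δ a b) : CurveClass.mk (sawCurve γ) = γ.curve := rfl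

/-! ### every point of the plane is within `1` of a site of the triangular lattice -/

theorem exists_site_norm_sub_triEmbed_le (p : ℂ) : ∃ y : Site 2, ‖p - triEmbed y‖ ≤ 1 := by
  have h3 : 0 < Real.sqrt 3 := by positivity
  set t : ℝ := p.im / (Real.sqrt 3 / 2) with ht
  set s : ℝ := p.re - t / 2 with hs
  have hp : p = (s : ℂ) + (t : ℂ) * triZeta := by
    apply Complex.ext
    · simp only [Complex.add_re, Complex.ofReal_re, Complex.mul_re, Complex.ofReal_im, triZeta_re,
        triZeta_im, zero_mul, sub_zero]
      rw [hs]; ring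
    · simp only [Complex.add_im, Complex.ofReal_im, Complex.mul_im, Complex.ofReal_re, triZeta_re,
        triZeta_im, zero_mul, add_zero, zero_add]
      rw [ht]; field_simp
  refine ⟨![round s, round t], ?_⟩
  have hy : triEmbed ![round s, round t] = ((round s : ℤ) : ℂ) + ((round t : ℤ) : ℂ) * triZeta := by
    simp [triEmbed]
  have hdiff : p - triEmbed ![round s, round t] =
      ((s - round s : ℝ) : ℂ) + ((t - round t : ℝ) : ℂ) * triZeta := by
    rw [hp, hy]; push_cast; ring
  rw [hdiff, ← sq_le_one_iff₀ (norm_nonneg _), Complex.sq_norm, normSq_add_mul_triZeta]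
  have ha := abs_sub_round s
  have hb := abs_sub_round t
  rw [abs_le] at ha hb
  nlinarith [sq_nonneg (s - round s + (t - round t)), sq_nonneg (s - round s), sq_nonneg (t - round t)]

/-- translation of faces by a site of the triangular lattice (kept as an opaque `def`) -/
def shiftFace (y : Site 2) (u : HexVertex) : HexVertex := (u.1 + y, u.2)

theorem shiftFace_shiftFace_neg (y : Site 2) (u : HexVertex) : shiftFace y (shiftFace (-y) u) = u := by
  obtain ⟨x, k⟩ := u
  simp [shiftFace]

/-- translating a face translates its centre -/
theorem hexCenter_shiftFace (y : Site 2) (u : HexVertex) :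
    hexCenter (shiftFace y u) = hexCenter u + triEmbed y := by
  obtain ⟨x, k⟩ := u
  simp only [shiftFace, hexCenter, triEmbed_add]
  ring

/-! ### at most `338` faces have their centre within `3` of the origin -/

/-- the box of faces `[-6, 6]² × {up, down}` (an opaque constant: unification must never unfold
the concrete `Finset`, whose normal form is too deep — `maximum recursion depth`) -/
def faceBox : Finset HexVertex := box 2 6 ×ˢ (Finset.univ : Finset (Fin 2))

theorem card_faceBox_le : faceBox.card ≤ 338 := by
  rw [faceBox, Finset.card_product, card_box, Finset.card_univ, Fintype.card_fin]
  norm_num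

/-- faces with `N ≤ 108` (i.e. centre of norm `≤ 3`) lie in the box `[-6, 6]² × {up, down}` -/
theorem mem_faceBox_of_cN_le {w : HexVertex} (hw : cN w ≤ 108) : w ∈ faceBox := by
  obtain ⟨x, k⟩ := w
  rw [faceBox, Finset.mem_product, mem_box]
  refine ⟨fun i => ?_, Finset.mem_univ _⟩
  have hk : ((k : ℕ) : ℤ) < 2 := by exact_mod_cast k.isLt
  have hk0 : (0 : ℤ) ≤ ((k : ℕ) : ℤ) := by exact_mod_cast Nat.zero_le _
  unfold cN cA cB at hw
  simp only at hw
  have hA : -6 ≤ 2 * x 0 + x 1 + ((k : ℕ) : ℤ) + 1 ∧ 2 * x 0 + x 1 + ((k : ℕ) : ℤ) + 1 ≤ 6 := by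
    constructor <;> nlinarith [sq_nonneg (3 * x 1 + ((k : ℕ) : ℤ) + 1),
      sq_nonneg (2 * x 0 + x 1 + ((k : ℕ) : ℤ) + 1 + 7), sq_nonneg (2 * x 0 + x 1 + ((k : ℕ) : ℤ) + 1 - 7)]
  have hB : -11 ≤ 3 * x 1 + ((k : ℕ) : ℤ) + 1 ∧ 3 * x 1 + ((k : ℕ) : ℤ) + 1 ≤ 11 := by
    constructor <;> nlinarith [sq_nonneg (2 * x 0 + x 1 + ((k : ℕ) : ℤ) + 1),
      sq_nonneg (3 * x 1 + ((k : ℕ) : ℤ) + 1 + 12), sq_nonneg (3 * x 1 + ((k : ℕ) : ℤ) + 1 - 12)]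
  fin_cases i
  · show -((6 : ℕ) : ℤ) ≤ x 0 ∧ x 0 ≤ ((6 : ℕ) : ℤ)
    push_cast
    omega
  · show -((6 : ℕ) : ℤ) ≤ x 1 ∧ x 1 ≤ ((6 : ℕ) : ℤ)
    push_cast
    omega

/-- centre of norm `≤ 3` ⇒ `N ≤ 108` -/
theorem cN_le_of_norm_le_three {w : HexVertex} (hw : ‖hexCenter w‖ ≤ 3) : cN w ≤ 108 := by
  have h := norm_sq_hexCenter w
  have h9 : ‖hexCenter w‖ ^ 2 ≤ 9 := by nlinarith [norm_nonneg (hexCenter w)]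
  have : (cN w : ℝ) ≤ 108 := by linarith
  exact_mod_cast this

/-- **Faces near a small ball are few**: the faces whose rescaled centre is within `2δ` of a point
`x` form a set of at most `338` elements (inside a translate of `faceBox`, `mem_faceBox_of_cN_le`). -/
theorem exists_finset_faces_near (x : ℂ) {δ : ℝ} (hδ : 0 < δ) :
    ∃ F : Finset HexVertex, F.card ≤ 338 ∧
      ∀ v : HexVertex, ‖(δ : ℂ) * hexCenter v - x‖ ≤ 2 * δ → v ∈ F := by
  classical
  obtain ⟨y, hy⟩ := exists_site_norm_sub_triEmbed_le (x / δ)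
  refine ⟨faceBox.image (shiftFace y), Finset.card_image_le.trans card_faceBox_le, ?_⟩
  intro v hv
  have hδ' : (δ : ℂ) ≠ 0 := by exact_mod_cast hδ.ne'
  have h1 : ‖hexCenter v - x / δ‖ ≤ 2 := by
    have : (δ : ℂ) * hexCenter v - x = (δ : ℂ) * (hexCenter v - x / δ) := by
      rw [mul_sub, mul_div_cancel₀ _ hδ']
    rw [this, norm_mul, Complex.norm_real, Real.norm_eq_abs, abs_of_pos hδ] at hv
    nlinarith
  have h2 : hexCenter (shiftFace (-y) v) = hexCenter v - triEmbed y := by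
    rw [hexCenter_shiftFace, triEmbed_neg, ← sub_eq_add_neg]
  have hnorm : ‖hexCenter (shiftFace (-y) v)‖ ≤ 3 := by
    rw [h2]
    calc ‖hexCenter v - triEmbed y‖ ≤ ‖hexCenter v - x / δ‖ + ‖x / δ - triEmbed y‖ :=
          norm_sub_le_norm_sub_add_norm_sub _ _ _
      _ ≤ 2 + 1 := add_le_add h1 hy
      _ = 3 := by norm_num
  have hmem : shiftFace (-y) v ∈ faceBox := mem_faceBox_of_cN_le (cN_le_of_norm_le_three hnorm)
  have himg := Finset.mem_image_of_mem (shiftFace y) hmem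
  rwa [shiftFace_shiftFace_neg] at himg

/-! ### consecutive vertices of a walk -/

theorem rel_of_mem_zip_of_isChain {α : Type*} {R : α → α → Prop} :
    ∀ (a : α) (l : List α), List.IsChain R (a :: l) → ∀ pq ∈ (a :: l).zip l, R pq.1 pq.2
  | a, [], _ => by simp
  | a, b :: l, h => by
    intro pq hpq
    rw [List.zip_cons_cons, List.mem_cons] at hpq
    rw [List.isChain_cons_cons] at h
    rcases hpq with rfl | hpq
    · exact h.1
    · exact rel_of_mem_zip_of_isChain b l h.2 pq hpq

/-- the short-distance cutoff threshold: `2 · (338² + 1) + 1` -/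
def hexCutoff : ℕ := 2 * (338 ^ 2 + 1) + 1

/-- **(H0) for SAW polylines.** At mesh `δ`, no shell `D(x; ρ, R)` with `ρ ≤ δ`, `ρ < R` is
traversed `hexCutoff` times by the polyline of a hexagonal SAW: the times spent in `B̄(x, ρ)` are
covered by at most (number of polyline segments meeting the ball) `+ 1` intervals
(`hasOrdConnectedCover_preimage_polylineFrom`), each such segment joins two of the `≤ 338` faces
within `2δ` of `x` and no ordered pair of faces is used twice (self-avoidance), and `m` intervals
allow at most `2m` separate traversals (`le_of_hasTraversals_of_hasOrdConnectedCover`). -/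
theorem not_hasTraversals_sawCurve (γ : HexDomainSAW Ω δ a b) (hδ : 0 < δ) {x : ℂ} {ρ R : ℝ}
    (hρδ : ρ ≤ δ) (hρR : ρ < R) : ¬ (sawCurve γ).HasTraversals hexCutoff x ρ R := by
  classical
  intro htr
  obtain ⟨F, hFcard, hF⟩ := exists_finset_faces_near x hδ
  set f : HexVertex → ℂ := fun w => (δ : ℂ) * hexCenter w with hf
  set l : List HexVertex := γ.walk.support.tail with hl
  have hsupp : γ.walk.support = a :: l := (SimpleGraph.Walk.cons_tail_support _).symm
  -- the polyline and its cover
  have hcurve : ∀ t, sawCurve γ t = (polylineFrom (f a) (l.map f)).2 t := by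
    intro t
    show (γ.walk.toCurve f) t = _
    rw [SimpleGraph.Walk.toCurve, hsupp, List.map_cons]
    rfl
  have hpre : (sawCurve γ) ⁻¹' closedBall x ρ = (polylineFrom (f a) (l.map f)).2 ⁻¹' closedBall x ρ := by
    ext t; simp only [mem_preimage, hcurve]
  have hcov := hasOrdConnectedCover_preimage_polylineFrom (convex_closedBall x ρ) (f a) (l.map f)
  rw [← hpre] at hcov
  -- counting the segments meeting the ball
  have hnd : ((a :: l).zip l).Nodup := by
    refine List.Nodup.of_map Prod.snd ?_
    rw [List.map_snd_zip (by simp)]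
    have := γ.isPath.support_nodup
    rw [hsupp, List.nodup_cons] at this
    exact this.2
  have hadj : ∀ pq ∈ (a :: l).zip l, hexGraph.Adj pq.1 pq.2 := fun pq hpq =>
    embDomainGraph_le _ _ _ _ (rel_of_mem_zip_of_isChain a l (hsupp ▸ γ.walk.isChain_adj_support) pq hpq)
  have hS : ∀ pq ∈ (a :: l).zip l, (segment ℝ (f pq.1) (f pq.2) ∩ closedBall x ρ).Nonempty →
      pq ∈ F ×ˢ F := by
    intro pq hpq hne
    obtain ⟨z, hzseg, hzball⟩ := hne
    rw [mem_closedBall] at hzball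
    have hd : dist (f pq.1) (f pq.2) ≤ δ := dist_smul_hexCenter_le_of_adj hδ le_rfl (hadj pq hpq)
    have hz1 : dist (f pq.1) z ≤ δ :=
      (mem_closedBall'.1 (segment_subset_closedBall_left (f pq.1) (f pq.2) hzseg)).trans hd
    have hz2 : dist (f pq.2) z ≤ δ := by
      have := segment_subset_closedBall_right (f pq.1) (f pq.2) hzseg
      rw [mem_closedBall, dist_comm] at this
      exact this.trans hd
    rw [Finset.mem_product]
    constructor
    · apply hF
      rw [← dist_eq_norm]
      linarith [dist_triangle (f pq.1) z x]
    · apply hF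
      rw [← dist_eq_norm]
      linarith [dist_triangle (f pq.2) z x]
  have hseg := segMeetCount_map_le_card (closedBall x ρ) f a l (F ×ˢ F) hnd hS
  have hk := le_of_hasTraversals_of_hasOrdConnectedCover hρR hcov htr
  have hFF : (F ×ˢ F).card ≤ 338 ^ 2 := by
    rw [Finset.card_product, sq]; exact Nat.mul_le_mul hFcard hFcard
  unfold hexCutoff at hk
  omega

/-- **AB99 hypothesis (H1) for the critical hexagonal SAW in `(D; a, b)`** — the rung that would
close the crux: for some shell-dependent threshold `k`, constants `K ≥ 0`, `λ > 2` and `δ₀ > 0`,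
for every mesh `δ ∈ (0, δ₀]` and every shell with `δ ≤ ρ < R ≤ 1`, the probability that the SAW
polyline traverses `D(x; ρ, R)` by `k x ρ R` separate segments is `≤ K (ρ/R)^λ`.
(Aizenman–Burchard, Duke Math. J. 99 (1999), (1.3); cf. Kemppainen–Smirnov 2017 Condition G2.)
OPEN: no tool gives it at `n = 0`. Recorded as a `def` only. -/
def HexTraversalBound (D : DobrushinDomain) (a b : ℝ → HexVertex) : Prop :=
  ∃ (k : ℂ → ℝ → ℝ → ℕ) (K lam δ₀ : ℝ), 0 ≤ K ∧ 2 < lam ∧ 0 < δ₀ ∧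
    ∀ δ ∈ Set.Ioc 0 δ₀, ∀ (x : ℂ) (ρ R : ℝ), δ ≤ ρ → ρ < R → R ≤ 1 →
      hexSAWLaw D.carrier δ (a δ) (b δ)
        {γ | (sawCurve γ).HasTraversals (k x ρ R) x ρ R} ≤ ENNReal.ofReal (K * (ρ / R) ^ lam)

/-- **The Aizenman–Burchard rung closes the crux.** (H1) for the hexagonal SAW in every
`(D; a, b)` with an endpoint approximation ⇒ `HexTight`: apply `isTightMeasureSet_of_traversalBounds`
on the honest window with `Λ = closedBall 0 r₀ ⊇ closure Ω`, the planar covering bound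
`exists_finset_card_le_cover_closedBall`, threshold `max hexCutoff k`, (H0) by
`not_hasTraversals_sawCurve`, and pass to the mesh filter by
`isTightAlongMesh_of_isTightMeasureSet_image`. -/
theorem crux_of_traversalBound
    (h : ∀ (D : DobrushinDomain) (a b : ℝ → HexVertex),
      IsEmbEndpointApprox hexGraph hexCenter D a b → HexTraversalBound D a b) : Crux := by
  intro D a b hab
  obtain ⟨k, K, lam, δ₀, hK, hlam, hδ₀, hbd⟩ := h D a b hab
  obtain ⟨δh, hδh, hhon⟩ := mem_nhdsGT_iff_exists_Ioo_subset.1 (eventually_ne_and_reachable hab)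
  have hδhpos : 0 < δh := hδh
  obtain ⟨R₀, hR₀⟩ := D.isBounded.subset_closedBall 0
  set r₀ : ℝ := |R₀| with hr₀
  have hΩ : D.carrier ⊆ closedBall 0 r₀ := hR₀.trans (closedBall_subset_closedBall (le_abs_self R₀))
  set δ₂ : ℝ := min (min δ₀ 1) (δh / 2) with hδ₂
  have hδ₂pos : 0 < δ₂ := lt_min (lt_min hδ₀ one_pos) (by positivity)
  have hT1 : Set.Ioc 0 δ₂ ⊆ Set.Ioc (0 : ℝ) 1 :=
    Set.Ioc_subset_Ioc_right ((min_le_left _ _).trans (min_le_right _ _))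
  have hT0 : Set.Ioc 0 δ₂ ⊆ Set.Ioc (0 : ℝ) δ₀ :=
    Set.Ioc_subset_Ioc_right ((min_le_left _ _).trans (min_le_left _ _))
  have hTh : ∀ δ ∈ Set.Ioc 0 δ₂, δ ∈ Set.Ioo 0 δh := fun δ hδ =>
    ⟨hδ.1, by have := (min_le_right _ _ : δ₂ ≤ δh / 2); linarith [hδ.2]⟩
  have key := isTightMeasureSet_of_traversalBounds (E := ℂ) (isCompact_closedBall (0 : ℂ) r₀)
    (C := 9 * (r₀ + 2) ^ 2) (d := 2) zero_le_two
    (fun ρ hρ hρ1 => exists_finset_card_le_cover_closedBall (abs_nonneg R₀) ρ hρ hρ1)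
    (Ω := fun δ => HexDomainSAW D.carrier δ (a δ) (b δ))
    (fun δ => hexSAWLaw D.carrier δ (a δ) (b δ)) (fun δ γ => sawCurve γ)
    (fun x ρ R => max hexCutoff (k x ρ R)) hK hlam hT1 ?_ ?_
  · have hfun : ∀ δ, (CurveClass.mk ∘ fun γ : HexDomainSAW D.carrier δ (a δ) (b δ) => sawCurve γ) =
        fun γ => γ.curve := fun δ => rfl
    simp only [hfun] at key
    exact isTightAlongMesh_of_isTightMeasureSet_image
      (Eventually.of_forall fun _ => aemeasurable_embCurve _ _ _ _ _ _ _) hδ₂pos key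
  · -- (H0)
    intro δ hδ
    refine ae_of_all _ fun γ => ⟨?_, fun x ρ R hρ hρδ hρR htr => ?_⟩
    · have hh := hhon (hTh δ hδ)
      have ha : a δ ∈ embMeshDomain hexGraph hexCenter D.carrier δ :=
        mem_embMeshDomain_of_reachable_of_ne hh.1 hh.2
      show (CurveClass.mk (sawCurve γ)).range ⊆ closedBall 0 r₀
      rw [mk_sawCurve]
      exact (curve_range_subset_closure γ (mem_closure_of_mem_embMeshDomain ha)).trans
        (closure_minimal hΩ isClosed_closedBall)
    · exact not_hasTraversals_sawCurve γ hδ.1 hρδ hρR (htr.of_le (le_max_left _ _))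
  · -- (H1)
    intro δ hδ x ρ R hδρ hρR hR1
    refine le_trans (measure_mono fun γ hγ => ?_) (hbd δ (hT0 hδ) x ρ R hδρ hρR hR1)
    exact hγ.of_le (le_max_right _ _)

end ABRung

/-! ## §7 Targets (generation 3): the ring barrier for Kemppainen–Smirnov-type stubs

The Lean content of this section lives in the proposal chain
`Summits/CriticalPhenomena/SAWScalingLimit/Theorems/HexTight/Negative/LatticeG2{Defs,Ring,Routes,False}.lean`
(it cannot be imported here before the farm builds it; once built, `Negative.not_latticeG2AsTyped :
¬ Negative.LatticeG2AsTyped`, and `Negative.LatticeG2AsTyped ↔ TipRenewalComplementarity.LatticeG2` is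
`Iff.rfl`). Construction (lattice units, for given `C > 1`, `n₁`): `r = max n₁ 1`, `R = C r + 1`,
`K = ⌈R⌉₊`; `Λ = ring K` = bottom row `U(i,0)` (`-3K < i ≤ K`), `D(i,0)` (`-3K ≤ i ≤ K`), right column
`U(K,j)`, `D(K,j)`, top row `U(i,2K)`, `D(i,2K)`, left column `U(-3K,j)`, `D(-3K,j)`; source
`t = {D(0,-1), U(0,0)}`, centre `x = c(U(0,0))`, target `z = {D(0,2K-1), U(0,2K)}`. Steps of the proof:
(1) off the bottom row the ring is at distance `≥ K ≥ R` (real/imaginary offsets), so annulus cells are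
bottom cells with real offset `≥ 1/2` or `≤ -1/2` (`re_dichotomy`); (2) adjacent cells differ by `≤ 1/2`
in real part, so a lattice path inside the annulus part never changes side (`re_pos_of_latticeJoined`):
the annulus component of a cell is contained in its side; (3) every arc `t → z` is a chain from distance
`0` to distance `≥ R > r + 1`, hence contains a crossing `u, u', …, w` with all interior cells in the open
annulus (`exists_crossing`: split at the first cell beyond `R`, then at the last cell within `r`; `u, w`
are not adjacent because an edge has length `≤ 1`), all in the component of `u'`; (4) the route round the
OTHER side (`joined_left` inside `Tneg`, `joined_right` inside `Tpos`) joins `U(0,0)` to `U(0,2K)` in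
`Λ` minus that component — so the crossing is UNFORCED; (5) `arcMassIf = arcMass > 0` (an arc exists:
bypass of the right route, `nonempty_saw`), contradicting `≤ q · arcMass` with `q < 1`.

What the provers should take from it: conditional (quenched, past-uniform) crossing bounds for a
WEIGHTED polymer must be stated on hole-free slit domains (or count only U-turns); the annealed
Aizenman–Burchard form (§6) and the virgin-disc forms are the robust ones. -/

end Summit.CriticalPhenomena.SAWScalingLimit.Cruxes.HexTight.Disproof
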